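import Literature.MathematicalPhysics.QuantumFieldTheory.Balaban1983to89.B4Thm110ZeroBoxDeriv

/-!
# `Balaban1983to89.B6Ineq243TwoLevelBox` — [B6] (2.41)–(2.43): the GENUINE two-level cube propagator `G′(□)` at
mesh `L^{−j}` on the box carriers of `B4BoxCov237` — Woodbury inversion of the two-level operator and the decay
(2.43)₁ `|(G′(□)λ)(x)| ≤ O(1)e^{−δ₀dist(x, supp λ)}|λ|`, UNIFORMLY IN `j` (no existing module is touched; no fact is
minted; every input is a kernel-proved theorem of the `B4*` package, consumed BY NAME)

FRAMING (verbatim cell line; v1.3 DOCFIX, referee asks ref-3 N-g26-1 / ref-4 g20 / ref-1 g29 / lead g6 — it was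
missing from v1–v1.2; prose only, no declaration changed):
statement-level skeleton of published theorems with citation tags; proofs where landed; nothing here is a claim about the Yang–Mills mass gap

Source under audit (cell pub-balaban): T. Bałaban, *Propagators and renormalization transformations for lattice gauge
theories. II*, Commun. Math. Phys. **96** (1984) 223–250 [`Balaban1984PropagatorsII`, "B6"], p. 230 [PDF 8]
(2.40)–(2.44), p. 225 [PDF 3] (2.13)–(2.14) (renders `b2b-balaban-ref1/pages/1984-cmp96-propagators-rt-II/…-p008-x2.png`,
`…-p003-x2.png`, read as images); T. Bałaban, *Regularity and decay of lattice Green's functions*, Commun. Math.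
Phys. **89** (1983) 571–597 [`Balaban1983RegularityDecay`, "[3]" of B6] — Theorem (1.10), Lemma 2.2, Lemma 2.4,
Proposition 2.3, as typed and PROVED at `A = 0` for boxes in `B4Thm110ZeroBox` / `B4BoxCov237`.

## WHAT IS PRINTED (p. 230, verbatim up to notation)

«If □ intersects both domains B^j(Λ_j) and B^{j+1}(Λ_{j+1}), then we express G′(□) in terms of operators introduced
in the paper. On the basis of the formulas (2.12), (2.13) [1] we have
e^{½⟨f,G′(□)f⟩} = Z^{−1}∫dλ exp[−½⟨λ,(Δ_□^{L^{−j},N} + Q′*aQ′↾_□)λ⟩ + ⟨λ,f⟩]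
 = Z′^{−1}∫dω↾_Λ exp[−½aL^{d−2}Σ_{y∈Λ′}|(Q′ω)(y)|²]·∫dλ exp[−½a_j‖ω − Q′_jλ‖² − ½⟨λ,Δ_□^{L^{−j},N}λ⟩ + ⟨λ,f⟩],  (2.41)
where Λ = □^{(j)} ∩ B(Λ_{j+1}) and ω is equal to 0 beyond Λ. Further, we have after the translation
λ → λ + G′_j(□)Q′_j*ω  …  = exp[½⟨f,G′_j(□)f⟩ + ⟨f,G′_j(□)Q′_j*C_Λ^{(j)}(□)Q′_jG′_j(□)f⟩].  (2.42)
Properties of the operators G′_j(□), G′_j(□)Q′_j* and C_Λ^{(j)}(□) are described in Lemmas 2.2, 2.4, Proposition 2.3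
[3]. From these and (2.42) we get
|(G′(□)λ)(x)|, |(∂^{L^{−j}}_μG′(□)λ)(x)| ≤ O(1)e^{−δ₀dist(x,supp λ)}|λ|.  (2.43)»
p. 225 (2.14): «⟨λ,Q′*aQ′λ⟩ = Σ_{j=0}^{k}Σ_{y∈Λ_j} a_j(L^jη)^{d−2}|(Q′_jλ)(y)|². The numbers a_j satisfy the recursive
equations a_{j+1} = aa_j/(aL^{−2} + a_j), a_1 = a (see [1, 2.13 and 2.15])»; p. 230 (2.40): «… or the last term
above is replaced by a term defined in the same way but with j + 1 instead of j and with the additional factor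
L^{−2} if x ∈ B^{j+1}(Λ_{j+1})».

## WHAT THIS FILE CERTIFIES (kernel-checked; `A = 0`; the lineage is USED, not re-proved)

On the `L^{−j}`-scale of (2.40)–(2.41) (`ξ = L^{−j} = 1/n` the fine spacing, the `j`-blocks the unit lattice, the
`(j+1)`-blocks the `L`-blocks, `L = ℓ + 1 ≥ 2`), for a box `□` built of `L`-blocks (fine box `X = Π[0, nLM′_μ)`,
unit box `□^{(j)} = Π[0, LM′_μ) ∩ ℤ^{d+1}`) and `Λ ⊆ □^{(j)}`:
* `twoLevelOp` — THE GENUINE TWO-LEVEL CUBE OPERATOR `Δ_□^{ξ,N} + m² + Q′*aQ′↾_□` of (2.41) as a real matrix (values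
  form, the units of `B4BoxCov237.boxOpR`): entries (`twoLevelOp_apply`, `Λ` a union of `L`-blocks)
  `n²(−Δ^N_X)(x,x′) + m²δ_{xx′} + a_jn^{−(d+1)}[x ∼_j x′]` if the `j`-block of `x` is NOT in `Λ` (level `j` of (2.14)),
  `… + a_{j+1}L^{−2}(nL)^{−(d+1)}[x ∼_{j+1} x′]` if it IS (level `j + 1`, «the additional factor L^{−2}»), with
  `a_{j+1} = aNext ℓ a_j a = aa_j/(aL^{−2} + a_j)` (`= B1.aSeq a L (j+1)` for `a_j = B1.aSeq a L j`, `aNext_aSeq`);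
* `gTwoLevel` — `G′(□) := G_j(□) + a_j²·G_j(□)Q_j^*1_ΛC_Λ^{(j)}(□)1_ΛQ_jG_j(□)` read off (2.42)
  (`G_j(□) = (boxOpR n a_j m² (LM′))⁻¹`, `C_Λ^{(j)}(□) = (covOpSub …)⁻¹`, `Q_j = n^{−(d+1)}indB`, `Q_j^* = indBᵀ`);
* **`twoLevelOp_mul_gTwoLevel` / `gTwoLevel_mul_twoLevelOp`**: for `n ≥ 1`, `a_j, a > 0`, `m² ≥ 0` and `Λ` a union of
  `L`-blocks, `G′(□)` IS THE TWO-SIDED INVERSE of the two-level operator — the operator content of (2.41)–(2.42)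
  for the genuine carriers (a Woodbury identity: `twoLevel_woodbury`, using `boxOpR_mul_inv`, the invertibility of
  the compression `cov116_box_finset_decay`, the idempotence `projΛ_mul_projΛ` of `ΛPΛ` for block unions, and the
  coefficient identity `aNext_coeff` — which is exactly where the recursion `a_{j+1} = aa_j/(aL^{−2} + a_j)` enters);
* **`ineq243_twoLevel_roww`** — (2.43), FIRST QUANTITY, UNIFORMLY IN THE MESH: for every window `a_j ∈ [a₋, a₊]`,
  `m² ∈ [0, m²₊]`, `a ∈ [a₂₋, a₂₊]` there are `δ′, c′ > 0` (depending on `d`, `ℓ`, the window only) with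
  `Σ_{x′}|G′(□; x, x′)|e^{δ′|x − x′|_∞/L^j} ≤ c′` for EVERY `j ≥ 1`, every box, EVERY `Λ` and every `x`; whence the
  printed value clause **`ineq243_twoLevel_value`** / `ineq243_twoLevel_dist`
  `|(G′(□)λ)(x)| ≤ c′e^{−δ′dist(x, supp λ)}‖λ‖_∞` (distance on the `L^{−j}`-scale) and `ineq243_twoLevel_value_aSeq`
  (along `a_j = B1.aSeq a L j`).  The proof is the printed route «From these and (2.42) we get (2.43)»: the uniform
  weighted row bound of `G_j(□)` ([3] Theorem (1.10)/Lemma 2.2 at `A = 0` for boxes, `thm110_zero_box_roww_coeff`),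
  the decay `|C_Λ^{(j)}(□; y, y′)| ≤ ce^{−δ|y−y′|}` ([3] Proposition 2.3 (1.16) for `Ω = □` and every `Λ`,
  `cov116_box_finset_decay`), the block bookkeeping `|x − x′|_∞ ≤ n(|blk x − blk x′|_∞ + 1)` and the fibre sum
  (`roww_mid_le`), and the submultiplicativity of weighted rows (`roww_mul_le`):
  `roww_{δ′}(G′) ≤ c₀ + a_j²·c₀(ce^{δ′}K_{d+1}(δ/2))c₀`, `δ′ = min(δ₀, δ/2)` (`gTwoLevel_roww_le`).

## DICTIONARY (typist's)

* fine site `x ∈ X = boxDom (n·L·M′)` ↔ `ξx ∈ □ ⊂ T_{L^{−j}}`; unit site `y = blk n x ∈ boxDom (L·M′)` ↔ `y ∈ □^{(j)}`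
  (`ublk`); `L`-block label `blk L y` ↔ point of `Λ′`/`□^{(j+1)}`; `Λ = □^{(j)} ∩ B(Λ_{j+1})` ↔ a `Finset` of unit
  sites closed under `L`-block-mates (`IsBlockUnion`; `isBlockUnion_of_blocks` = the sites over a set of blocks).
* `Q′_j`, `Q′_j*` ↔ `n^{−(d+1)}indB`, `indBᵀ` (`B4BoxCov237`); `1_ΛQ_j·n^{d+1}` ↔ `indBΛ n Λ` (rows in `Λ`);
  `P` of [3] (1.13) ↔ `blockAvgP ℓ M′`, `ΛPΛ` ↔ `projΛ`; `G′_j(□)` ↔ `(boxOpR n a_j m² (LM′))⁻¹` ([3] (2.44));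
  `C_Λ^{(j)}(□)` ↔ `cΛ = (covOpSub n ℓ a_j a m² M′ incl)⁻¹` ([3] (1.13), `B4BoxCov237` §8); `G′(□)` ↔ `gTwoLevel`;
  `Δ_□^{L^{−j},N} + Q′*aQ′↾_□` (+ `m²`) ↔ `twoLevelOp`.
* `dist(x, supp λ)` on the `L^{−j}`-scale ↔ `D/n`, `D ≤ |x − x′|_∞` (fine units) on `supp λ` (`dsupp`); `|λ|` ↔ `‖λ‖_∞`.

## HONEST SCOPE

* `A = 0` only (as everywhere in the `B4*` package); only the FIRST quantity of (2.43) (the derivative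
  `∂^{L^{−j}}_μG′(□)λ` is not typed); the mass `m² ≥ 0` is a free window parameter (`m² = 0` in [B6]); the
  coefficient `a_j` ranges over a window (the printed `a_j = B1.aSeq a L j` is the corollary `…_aSeq`).
* The Gaussian-integral lines of (2.41)–(2.42) are NOT re-derived here (they are `B6Eq242LocalPropagator.eq242`
  over abstract carriers and `B6Eq241TwoLevelWeights.eq241_first_line` for the genuine weights); this file certifies
  their OPERATOR content on the concrete carriers: `G′(□)` of (2.42) inverts the two-level operator of (2.41).
* The decay estimate holds for every `Λ ⊆ □^{(j)}` (at `A = 0` no block structure is needed, cf. `B4BoxCov237` §8);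
  the union-of-blocks structure is used only in the inversion.  Constants depend on `d`, `ℓ` and the window; no
  claim about their size.  Boxes are anchored at the origin with side lengths multiples of `L` (the typing of
  `B4BoxCov237`); `□` a rectangular parallelepiped only.
* Nothing is inferred from the manuscript: every step is kernel-checked; the quoted sentences locate the statement.

## v1.1 (append-only; §7–§8; import raised to `B4Thm110ZeroBoxDeriv`)

* §7 **(2.43), SECOND QUANTITY** `∂^{L^{−j}}_μG′(□)`: `ineq243_twoLevel_deriv_wsum` — for every window there are
  `δ′, c′ > 0` with `Σ_{x′}|ξ^{−1}(G′(□; x + ξe_μ, x′) − G′(□; x, x′))|e^{δ′|x−x′|_∞/L^j} ≤ c′` for EVERY `j ≥ 1`, box,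
  `Λ`, axis `μ` and pair of fine neighbours `x, x + ξe_μ` — from the derivative clause of [3] Theorem (1.10) at
  `A = 0` for boxes (`B4Thm110ZeroBoxDeriv.thm110_zero_box_deriv_roww_coeff`, weighted differenced rows of `G_j(□)`)
  composed with the middle factor of §4 (`wsum_vecMul_le`, `gTwoLevel_deriv_wsum_le`); the printed value clause
  `ineq243_twoLevel_deriv_value`: `|ξ^{−1}((G′(□)λ)(x + ξe_μ) − (G′(□)λ)(x))| ≤ c′e^{−δ′dist(x, supp λ)}‖λ‖_∞`.
* §8 **(2.44) AT MESH `L^{−j}`**: `kComm D h = hD − Dh` (the `K(h)` of (2.38); `eq238_box`: `D(hG′(□)h) = h² − K(h)G′(□)h`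
  when `DG′(□) = 1`), the summation by parts (2.40) at a point (`kComm_mulVec`, `lap_comm_sum_eq`,
  `twoLevelOp_apply'`, `vEntry`, `sum_vEntry_le`), the deterministic estimate `kComm_gTwoLevel_pointwise` and
  **`ineq244_twoLevel`**: for every window there are `δ′, C > 0` with
  `|(K(h)G′(□)g)(x)| ≤ C(κ₁ + κ₂)e^{−δ′dist(x, supp g)}‖g‖_∞` for EVERY `j ≥ 1`, box, block union `Λ`, every cut-off `h`
  with unit-scale Lipschitz constant `κ₁` and unit-scale Laplacian bound `κ₂` (for the rescaled profiles `h_□` of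
  (2.36), `κ₁ = O(M^{−1})`, `κ₂ = O(M^{−2})`: the printed `O(M^{−1})`), and every `g` (e.g. `h_□λ`).  HONEST SCOPE of §8:
  the box (Neumann) operator in place of the torus `Δ′_a` (equal on cut-offs vanishing at `∂□`; that identification and
  the sum over the cover (2.38) are `B6Eq250`/`B6Ineq249Proof`, not re-proved); `dist(x, supp g)` in place of the
  block label `y` of «supp λ ⊂ B^j(y)».

## v1.2 (append-only; §10)

* `eq240_twoLevel` — **(2.40) for the genuine two-level operator** as an exact identity (the three printed terms, both
  branches `j`/`j + 1` via `vEntry`, `vEntry_eq`); `cΛ_isSymm`, `gTwoLevel_isSymm` (G′(□) symmetric) and the uniform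
  `ℓ^∞`/`ℓ¹` operator bounds `ineq243_twoLevel_rowSum_colSum`.

Value = kernel certificate of the operator identity (2.41)–(2.42) and of (2.43)₁ for the genuine two-level cube
propagator at `A = 0`, uniformly in the mesh; NOT summit progress (the Yang–Mills statements are untouched).
-/

namespace Literature.MathematicalPhysics.QuantumFieldTheory.Balaban1983to89.B6Ineq243TwoLevelBox

open Finset Matrix

noncomputable section

section Woodbury

variable {X S : Type*} [Fintype X] [Fintype S]

/-- **EXPANSION**: for `A G = 1`, `(A − ν TᵀWT)(G + cν·G Tᵀ C T G) = 1 + ν·Tᵀ[c C − W − cν·W(TGTᵀ)C](TG)` — the algebraic skeleton of the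
operator content of (2.42). [cite: Balaban1984PropagatorsII, (2.41)–(2.42) p.230 (operator content)] -/
theorem twoLevel_expand [DecidableEq X] (A G : Matrix X X ℝ) (T : Matrix S X ℝ) (W C : Matrix S S ℝ)
    (ν c : ℝ) (hAG : A * G = 1) :
    (A - ν • (Tᵀ * W * T)) * (G + (c * ν) • (G * Tᵀ * C * T * G))
      = 1 + ν • (Tᵀ * (c • C - W - (c * ν) • (W * (T * G * Tᵀ) * C)) * (T * G)) := by
  have hAG' : ∀ Z : Matrix X X ℝ, A * (G * Z) = Z := fun Z => by
    rw [← Matrix.mul_assoc, hAG, Matrix.one_mul]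
  simp only [Matrix.mul_add, Matrix.mul_sub, Matrix.sub_mul, Matrix.mul_smul, Matrix.smul_mul,
    Matrix.mul_assoc, hAG, hAG']
  module

/-- **THE BRACKET VANISHES**: with `K = a_j − a_j²ν·TGTᵀ + α₂P`, `K C = 1`, `P² = P`, `W = a_j − wP` and
`w(a_j + α₂) = α₂a_j`:  `a_j²C − W − a_j²ν·W(TGTᵀ)C = 0`.
[cite: Balaban1984PropagatorsII, (2.41)–(2.42) p.230 (operator content) with (2.14) p.225 (the recursion)] -/
theorem bracket_eq_zero [DecidableEq S] (T : Matrix S X ℝ) (G : Matrix X X ℝ) (P C : Matrix S S ℝ)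
    (aj w α₂ ν : ℝ)
    (hKC : (aj • (1 : Matrix S S ℝ) - (aj ^ 2 * ν) • (T * G * Tᵀ) + α₂ • P) * C = 1)
    (hP : P * P = P) (hw : w * (aj + α₂) = α₂ * aj) :
    (aj ^ 2) • C - (aj • (1 : Matrix S S ℝ) - w • P)
        - (aj ^ 2 * ν) • ((aj • (1 : Matrix S S ℝ) - w • P) * (T * G * Tᵀ) * C) = 0 := by
  have h1 : (aj ^ 2 * ν) • (T * G * Tᵀ * C) = aj • C + α₂ • (P * C) - 1 := by
    have h := hKC
    rw [Matrix.add_mul, Matrix.sub_mul, Matrix.smul_mul, Matrix.smul_mul, Matrix.smul_mul,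
      Matrix.one_mul] at h
    calc (aj ^ 2 * ν) • (T * G * Tᵀ * C)
        = aj • C + α₂ • (P * C) - (aj • C - (aj ^ 2 * ν) • (T * G * Tᵀ * C) + α₂ • (P * C)) := by
          module
      _ = _ := by rw [h]
  have h2 : (aj ^ 2 * ν) • ((aj • (1 : Matrix S S ℝ) - w • P) * (T * G * Tᵀ) * C)
      = aj • ((aj • (1 : Matrix S S ℝ) - w • P) * C)
          + α₂ • ((aj • (1 : Matrix S S ℝ) - w • P) * P * C) - (aj • (1 : Matrix S S ℝ) - w • P) := by
    rw [Matrix.mul_assoc, ← Matrix.mul_smul, h1, Matrix.mul_sub, Matrix.mul_add, Matrix.mul_smul,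
      Matrix.mul_smul, Matrix.mul_one, Matrix.mul_assoc]
  rw [h2]
  have h3 : (aj • (1 : Matrix S S ℝ) - w • P) * P = (aj - w) • P := by
    rw [Matrix.sub_mul, Matrix.smul_mul, Matrix.smul_mul, Matrix.one_mul, hP, sub_smul]
  rw [h3, Matrix.smul_mul, Matrix.sub_mul, Matrix.smul_mul, Matrix.one_mul, Matrix.smul_mul]
  have hcoef : aj * w - α₂ * aj + α₂ * w = 0 := by linear_combination hw
  have h4 : (aj ^ 2) • C - (aj • (1 : Matrix S S ℝ) - w • P)
      - (aj • (aj • C - w • (P * C)) + α₂ • ((aj - w) • (P * C)) - (aj • (1 : Matrix S S ℝ) - w • P))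
      = (aj * w - α₂ * aj + α₂ * w) • (P * C) := by
    module
  rw [h4, hcoef, zero_smul]

/-- **TWO-LEVEL WOODBURY**: under the hypotheses of `bracket_eq_zero` and `A G = 1`,
`(A − ν·Tᵀ(a_j − wP)T)·(G + a_j²ν·G Tᵀ C T G) = 1`.
[cite: Balaban1984PropagatorsII, (2.41)–(2.42) p.230 (operator content)] -/
theorem twoLevel_woodbury [DecidableEq X] [DecidableEq S] (A G : Matrix X X ℝ) (T : Matrix S X ℝ)
    (P C : Matrix S S ℝ) (aj w α₂ ν : ℝ) (hAG : A * G = 1)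
    (hKC : (aj • (1 : Matrix S S ℝ) - (aj ^ 2 * ν) • (T * G * Tᵀ) + α₂ • P) * C = 1)
    (hP : P * P = P) (hw : w * (aj + α₂) = α₂ * aj) :
    (A - ν • (Tᵀ * (aj • (1 : Matrix S S ℝ) - w • P) * T))
        * (G + (aj ^ 2 * ν) • (G * Tᵀ * C * T * G)) = 1 := by
  rw [twoLevel_expand A G T _ C ν (aj ^ 2) hAG, bracket_eq_zero T G P C aj w α₂ ν hKC hP hw,
    Matrix.mul_zero, Matrix.zero_mul, smul_zero, add_zero]

end Woodbury

open Literature.MathematicalPhysics.QuantumFieldTheory.Balaban1983to89.B4ContourShift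
open Literature.MathematicalPhysics.QuantumFieldTheory.Balaban1983to89.B4Reflection242
open Literature.MathematicalPhysics.QuantumFieldTheory.Balaban1983to89.B4Green242Bridge
open Literature.MathematicalPhysics.QuantumFieldTheory.Balaban1983to89.B4BoxCov237
open Literature.MathematicalPhysics.QuantumFieldTheory.Balaban1983to89.B4Thm110ZeroBox
open B4Sect5Proof (latticeConst latticeConst_nonneg)

variable {d : ℕ}

/-! ## §2 The genuine two-level cube operator and its propagator `G′(□)` on the box carriers of `B4BoxCov237` -/

/-- **THE NEXT RUNNING CONSTANT** `a_{j+1} = a·a_j/(a·L⁻² + a_j)`, `L = ℓ + 1` — the recursion (2.15) of [1]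
(`B1.aSeq_succ`; for `a_j = B1.aSeq a L j` it IS `B1.aSeq a L (j+1)`, `aNext_aSeq`).
[cite: Balaban1982Higgs1, (2.13)/(2.15) p.609] -/
def aNext (ℓ : ℕ) (aj a : ℝ) : ℝ := a * aj / (a * ((((ℓ : ℝ) + 1)) ^ 2)⁻¹ + aj)

/-- `aNext ℓ (a_j) a = a_{j+1}` along Bałaban's sequence `a_j = B1.aSeq a L j` (`j ≥ 1`).
[cite: Balaban1982Higgs1, (2.15) p.609] -/
theorem aNext_aSeq {ℓ : ℕ} (hℓ : 1 ≤ ℓ) {a : ℝ} (ha : 0 < a) {j : ℕ} (hj : 1 ≤ j) :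
    aNext ℓ (B1.aSeq a ((ℓ : ℝ) + 1) j) a = B1.aSeq a ((ℓ : ℝ) + 1) (j + 1) :=
  (B1.aSeq_succ ha (one_lt_L_real hℓ) hj).symm

/-- the coefficient identity behind the Woodbury inversion: `w(a_j + aL⁻²) = aL⁻²·a_j` for `w = a_{j+1}L⁻²`.
[cite: Balaban1984PropagatorsII, (2.14) p.225 («a_{j+1} = aa_j/(aL^{−2} + a_j)»)] -/
theorem aNext_coeff (ℓ : ℕ) {aj a : ℝ} (haj : 0 < aj) (ha : 0 ≤ a) :
    aNext ℓ aj a / (((ℓ : ℝ) + 1)) ^ 2 * (aj + a / (((ℓ : ℝ) + 1)) ^ 2) = a / (((ℓ : ℝ) + 1)) ^ 2 * aj := by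
  unfold aNext
  have hL : (0 : ℝ) < (((ℓ : ℝ) + 1)) ^ 2 := by positivity
  have hden : 0 < a * ((((ℓ : ℝ) + 1)) ^ 2)⁻¹ + aj := by positivity
  field_simp
  ring

/-- the unit site (block label) over a fine site: `x ↦ blk n x ∈ □^{(j)}`. [folklore] -/
def ublk {n : ℕ} (hn : 1 ≤ n) {M : Fin (d + 1) → ℕ} (x : ↥(boxDom (fun i => n * M i))) : ↥(boxDom M) :=
  ⟨blk n x.1, blk_mem_boxDom hn x.2⟩

/-- the rows in `Λ ⊆ □^{(j)}` of the block indicator: `indBΛ n Λ (y, x) = [blk n x = y]` (`y ∈ Λ`, `x` fine) — the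
matrix of `n^{d+1}·1_ΛQ_j`; its transpose is the matrix of `Q_j^*1_Λ` (piecewise-constant extension of `ω ↾ Λ`).
[cite: Balaban1983RegularityDecay, p. 572 (1.4), dictionary] [folklore] -/
def indBΛ (n : ℕ) {M : Fin (d + 1) → ℕ} (Λ : Finset ↥(boxDom M)) :
    Matrix ↥Λ ↥(boxDom (fun i => n * M i)) ℝ :=
  (indB n M).submatrix (fun y => y.1) id

/-- entries of `indBΛ`. [cite: Balaban1983RegularityDecay, p. 572 (1.4), dictionary] -/
theorem indBΛ_apply (n : ℕ) {M : Fin (d + 1) → ℕ} (Λ : Finset ↥(boxDom M)) (y : ↥Λ)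
    (x : ↥(boxDom (fun i => n * M i))) : indBΛ n Λ y x = if blk n x.1 = y.1.1 then 1 else 0 := rfl

/-- the compression `ΛPΛ` of the `L`-block projection `P` of (1.13) to `Λ` (an operator on `ℓ²(Λ)`).
[cite: Balaban1983RegularityDecay, p. 573 (1.13) («X|_Λ = ΛXΛ»), dictionary] [folklore] -/
def projΛ (ℓ : ℕ) (M' : Fin (d + 1) → ℕ) (Λ : Finset ↥(boxDom (fun i => (ℓ + 1) * M' i))) :
    Matrix ↥Λ ↥Λ ℝ :=
  (blockAvgP ℓ M').submatrix (fun y => y.1) (fun y => y.1)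

/-- «Λ being a sum of big blocks»: `Λ ⊆ □^{(j)}` is a union of `L`-blocks (closed under passing to a site of the
same `L`-block). [cite: Balaban1984PropagatorsII, p.230 («Λ = □^{(j)} ∩ B(Λ_{j+1})»)] [folklore] -/
def IsBlockUnion (ℓ : ℕ) (M' : Fin (d + 1) → ℕ) (Λ : Finset ↥(boxDom (fun i => (ℓ + 1) * M' i))) : Prop :=
  ∀ y ∈ Λ, ∀ y' : ↥(boxDom (fun i => (ℓ + 1) * M' i)), blk (ℓ + 1) y'.1 = blk (ℓ + 1) y.1 → y' ∈ Λ

/-- **THE GENUINE TWO-LEVEL CUBE OPERATOR `Δ_□^{L^{−j},N} + Q′*aQ′↾_□` OF [B6] (2.41)** at `A = 0`, as a real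
matrix on the fine box `X = Π[0, n·L·M′_μ)` (`n = L^j` fine points per unit length; values form, lattice units of
`B4BoxCov237.boxOpR`): `n²(−Δ^N_X) + m² + n^{−(d+1)}·indBᵀ·W·indB` with the two-level weight
`W = a_j(1 − 1_Λ) + a_{j+1}L^{−2}·ΛPΛ` on the unit box — i.e. `a_jQ_j^*Q_j` on the `j`-blocks outside `Λ` (level
`j`) and `a_{j+1}L^{−2}Q_{j+1}^*Q_{j+1} = a_{j+1}L^{−2}Q_j^*PQ_j` on the `(j+1)`-blocks of `Λ` (level `j + 1`,
«the additional factor L^{−2}» of (2.40)); written as `boxOpR − n^{−(d+1)}·indBΛᵀ(a_j − a_{j+1}L^{−2}ΛPΛ)indBΛ`.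
The mass `m² ≥ 0` is a free parameter (`m² = 0` in [B6]).
[cite: Balaban1984PropagatorsII, (2.41) p.230 with (2.13)–(2.14) p.225 and (2.40) p.230] -/
def twoLevelOp (n ℓ : ℕ) (aj a m2 : ℝ) (M' : Fin (d + 1) → ℕ)
    (Λ : Finset ↥(boxDom (fun i => (ℓ + 1) * M' i))) :
    Matrix ↥(boxDom (fun i => n * ((ℓ + 1) * M' i))) ↥(boxDom (fun i => n * ((ℓ + 1) * M' i))) ℝ :=
  boxOpR n aj m2 (fun i => (ℓ + 1) * M' i)
    - (((n : ℝ) ^ (d + 1))⁻¹) • ((indBΛ n Λ)ᵀ * (aj • (1 : Matrix ↥Λ ↥Λ ℝ)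
        - (aNext ℓ aj a / (((ℓ : ℝ) + 1)) ^ 2) • projΛ ℓ M' Λ) * indBΛ n Λ)

/-- `C_Λ^{(j)}(□) = ((Δ^{(j)}(□) + aL^{−2}P)|_Λ)^{−1}` — the inverse of the compression `B4BoxCov237.covOpSub` along
the inclusion of `Λ`. [cite: Balaban1983RegularityDecay, p. 573 (1.13), dictionary] -/
def cΛ (n ℓ : ℕ) (aj a m2 : ℝ) (M' : Fin (d + 1) → ℕ) (Λ : Finset ↥(boxDom (fun i => (ℓ + 1) * M' i))) :
    Matrix ↥Λ ↥Λ ℝ :=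
  (covOpSub n ℓ aj a m2 M' (fun y : ↥Λ => y.1))⁻¹

/-- **THE TWO-LEVEL CUBE PROPAGATOR `G′(□)` OF [B6] (2.42)**:
`G′(□) = G_j(□) + a_j²·G_j(□)Q_j^*1_Λ C_Λ^{(j)}(□) 1_ΛQ_jG_j(□)` with `G_j(□) = (boxOpR n a_j m² (L·M′))⁻¹`
(B4 (2.44)), `Q_j = n^{−(d+1)}indB`, `Q_j^* = indBᵀ` — the operator read off the exponent of the last line of
(2.42) (coefficient bookkeeping as in `B6Eq242LocalPropagator.gPrimeBox`, GAPS G-B6-03).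
[cite: Balaban1984PropagatorsII, (2.42) p.230] -/
def gTwoLevel (n ℓ : ℕ) (aj a m2 : ℝ) (M' : Fin (d + 1) → ℕ)
    (Λ : Finset ↥(boxDom (fun i => (ℓ + 1) * M' i))) :
    Matrix ↥(boxDom (fun i => n * ((ℓ + 1) * M' i))) ↥(boxDom (fun i => n * ((ℓ + 1) * M' i))) ℝ :=
  (boxOpR n aj m2 (fun i => (ℓ + 1) * M' i))⁻¹
    + (aj ^ 2 * ((n : ℝ) ^ (d + 1))⁻¹) •
      ((boxOpR n aj m2 (fun i => (ℓ + 1) * M' i))⁻¹ * (indBΛ n Λ)ᵀ * cΛ n ℓ aj a m2 M' Λ * indBΛ n Λ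
        * (boxOpR n aj m2 (fun i => (ℓ + 1) * M' i))⁻¹)

/-- **DICTIONARY** `(Δ^{(j)}(□) + aL^{−2}P)|_Λ = a_j·1 − a_j²n^{−(d+1)}·(1_ΛQ_j)G_j(□)(Q_j^*1_Λ) + aL^{−2}·ΛPΛ` — the
compression of `B4BoxCov237.covOp` along the inclusion of `Λ`, in the shape used by the Woodbury identity.
[cite: Balaban1983RegularityDecay, p. 573 (1.13)–(1.14), dictionary] -/
theorem kΛ_eq_covOpSub (n ℓ : ℕ) (aj a m2 : ℝ) (M' : Fin (d + 1) → ℕ)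
    (Λ : Finset ↥(boxDom (fun i => (ℓ + 1) * M' i))) :
    aj • (1 : Matrix ↥Λ ↥Λ ℝ)
        - (aj ^ 2 * ((n : ℝ) ^ (d + 1))⁻¹) •
            (indBΛ n Λ * (boxOpR n aj m2 (fun i => (ℓ + 1) * M' i))⁻¹ * (indBΛ n Λ)ᵀ)
        + (a / (((ℓ : ℝ) + 1)) ^ 2) • projΛ ℓ M' Λ
      = covOpSub n ℓ aj a m2 M' (fun y : ↥Λ => y.1) := by
  ext y y'
  simp only [covOpSub_apply, covOp, Keff, projΛ, indBΛ, Matrix.add_apply, Matrix.sub_apply,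
    Matrix.smul_apply, Matrix.one_apply, Matrix.submatrix_apply, Matrix.mul_apply, Matrix.transpose_apply,
    id, smul_eq_mul, Subtype.ext_iff]

/-- `ΛPΛ` is idempotent when `Λ` is a union of `L`-blocks (every `L`-block of a site of `Λ` lies in `Λ` and has
`L^{d+1}` sites, `card_filter_blk`). [cite: Balaban1983RegularityDecay, p. 573 (1.13) («P(A) = Q^*(A)Q(A)», «X|_Λ = ΛXΛ»)
with p. 574 («Λ being a sum of big blocks»), dictionary] -/
theorem projΛ_mul_projΛ {ℓ : ℕ} {M' : Fin (d + 1) → ℕ} {Λ : Finset ↥(boxDom (fun i => (ℓ + 1) * M' i))}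
    (hΛ : IsBlockUnion ℓ M' Λ) : projΛ ℓ M' Λ * projΛ ℓ M' Λ = projΛ ℓ M' Λ := by
  ext y y''
  rw [Matrix.mul_apply]
  simp only [projΛ, Matrix.submatrix_apply, blockAvgP, Matrix.of_apply]
  have hL1 : 1 ≤ ℓ + 1 := by omega
  have hLpos : (0 : ℝ) < (((ℓ : ℝ) + 1)) ^ (d + 1) := by positivity
  by_cases hb : blk (ℓ + 1) y.1.1 = blk (ℓ + 1) y''.1.1
  · rw [if_pos hb]
    have hterm : ∀ y' : ↥Λ,
        (if blk (ℓ + 1) y.1.1 = blk (ℓ + 1) y'.1.1 then ((((ℓ : ℝ) + 1) ^ (d + 1))⁻¹ : ℝ) else 0)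
          * (if blk (ℓ + 1) y'.1.1 = blk (ℓ + 1) y''.1.1 then ((((ℓ : ℝ) + 1) ^ (d + 1))⁻¹ : ℝ) else 0)
        = if blk (ℓ + 1) y'.1.1 = blk (ℓ + 1) y.1.1 then
            ((((ℓ : ℝ) + 1) ^ (d + 1))⁻¹ : ℝ) * ((((ℓ : ℝ) + 1) ^ (d + 1))⁻¹ : ℝ) else 0 := by
      intro y'
      by_cases h1 : blk (ℓ + 1) y'.1.1 = blk (ℓ + 1) y.1.1
      · rw [if_pos h1.symm, if_pos (h1.trans hb), if_pos h1]
      · rw [if_neg (fun h => h1 h.symm), zero_mul, if_neg h1]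
    rw [Finset.sum_congr rfl (fun y' _ => hterm y'), ← Finset.sum_filter, Finset.sum_const, nsmul_eq_mul]
    have hcard : (Finset.univ.filter (fun y' : ↥Λ => blk (ℓ + 1) y'.1.1 = blk (ℓ + 1) y.1.1)).card
        = (ℓ + 1) ^ (d + 1) := by
      rw [← card_filter_blk hL1 M' ⟨blk (ℓ + 1) y.1.1, blk_mem_boxDom hL1 y.1.2⟩]
      rw [← Finset.card_map ⟨(fun y' : ↥Λ => y'.1), Subtype.val_injective⟩]
      congr 1
      ext z
      simp only [Finset.mem_map, Finset.mem_filter, Finset.mem_univ, true_and, Function.Embedding.coeFn_mk]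
      constructor
      · rintro ⟨y', hy', rfl⟩
        exact hy'
      · intro hz
        exact ⟨⟨z, hΛ y.1 y.2 z hz⟩, hz, rfl⟩
    rw [hcard]
    push_cast
    field_simp
  · rw [if_neg hb]
    refine Finset.sum_eq_zero fun y' _ => ?_
    by_cases h1 : blk (ℓ + 1) y.1.1 = blk (ℓ + 1) y'.1.1
    · rw [if_neg (fun h2 => hb (h1.trans h2)), mul_zero]
    · rw [if_neg h1, zero_mul]

/-- **(2.42) ⇒ THE TWO-LEVEL PROPAGATOR INVERTS THE GENUINE TWO-LEVEL CUBE OPERATOR**: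
`(Δ_□ + Q′*aQ′↾_□)·G′(□) = 1` for every `n ≥ 1`, `L = ℓ + 1 ≥ 2`, `a_j > 0`, `a > 0`, `m² ≥ 0`, every box built of
`L`-blocks and every `Λ ⊆ □^{(j)}` that is a union of `L`-blocks — the Woodbury identity over the concrete carriers
(`B4BoxCov237.boxOpR_mul_inv`, `cov116_box_finset_decay` for the invertibility of the compression,
`projΛ_mul_projΛ`, `aNext_coeff`). [cite: Balaban1984PropagatorsII, (2.41)–(2.42) p.230] -/
theorem twoLevelOp_mul_gTwoLevel {n ℓ : ℕ} (hn : 1 ≤ n) (hℓ : 1 ≤ ℓ) {aj a m2 : ℝ} (haj : 0 < aj) (ha : 0 < a)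
    (hm : 0 ≤ m2) {M' : Fin (d + 1) → ℕ} (hM : ∀ i, 1 ≤ M' i)
    {Λ : Finset ↥(boxDom (fun i => (ℓ + 1) * M' i))} (hΛ : IsBlockUnion ℓ M' Λ) :
    twoLevelOp n ℓ aj a m2 M' Λ * gTwoLevel n ℓ aj a m2 M' Λ = 1 := by
  have hMℓ : ∀ i, 1 ≤ (ℓ + 1) * M' i := fun i => by nlinarith [hM i]
  have hAG := boxOpR_mul_inv hn haj hm (M := fun i => (ℓ + 1) * M' i) hMℓ
  obtain ⟨δ, c, -, -, h⟩ := cov116_box_finset_decay d ℓ hℓ aj aj m2 a a haj ha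
  have hKC : (aj • (1 : Matrix ↥Λ ↥Λ ℝ)
      - (aj ^ 2 * ((n : ℝ) ^ (d + 1))⁻¹) •
          (indBΛ n Λ * (boxOpR n aj m2 (fun i => (ℓ + 1) * M' i))⁻¹ * (indBΛ n Λ)ᵀ)
      + (a / (((ℓ : ℝ) + 1)) ^ 2) • projΛ ℓ M' Λ) * cΛ n ℓ aj a m2 M' Λ = 1 := by
    rw [kΛ_eq_covOpSub]
    exact (h n hn aj m2 a le_rfl le_rfl hm le_rfl le_rfl le_rfl M' hM Λ).1
  exact twoLevel_woodbury _ _ _ _ _ aj _ _ _ hAG hKC (projΛ_mul_projΛ hΛ) (aNext_coeff ℓ haj ha.le)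

/-- … and `G′(□)·(Δ_□ + Q′*aQ′↾_□) = 1`: `G′(□)` is THE inverse of the genuine two-level cube operator.
[cite: Balaban1984PropagatorsII, (2.41)–(2.42) p.230] -/
theorem gTwoLevel_mul_twoLevelOp {n ℓ : ℕ} (hn : 1 ≤ n) (hℓ : 1 ≤ ℓ) {aj a m2 : ℝ} (haj : 0 < aj) (ha : 0 < a)
    (hm : 0 ≤ m2) {M' : Fin (d + 1) → ℕ} (hM : ∀ i, 1 ≤ M' i)
    {Λ : Finset ↥(boxDom (fun i => (ℓ + 1) * M' i))} (hΛ : IsBlockUnion ℓ M' Λ) :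
    gTwoLevel n ℓ aj a m2 M' Λ * twoLevelOp n ℓ aj a m2 M' Λ = 1 :=
  mul_eq_one_comm.1 (twoLevelOp_mul_gTwoLevel hn hℓ haj ha hm hM hΛ)



/-- the canonical `Λ = □^{(j)} ∩ B(Λ_{j+1})`: the unit sites whose `L`-block lies in a given set `B` of blocks form a
union of `L`-blocks. [cite: Balaban1984PropagatorsII, p.230 («Λ = □^{(j)} ∩ B(Λ_{j+1})»), dictionary] -/
theorem isBlockUnion_of_blocks (ℓ : ℕ) (M' : Fin (d + 1) → ℕ) (B : Finset ↥(boxDom M')) :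
    IsBlockUnion ℓ M' (Finset.univ.filter fun y : ↥(boxDom (fun i => (ℓ + 1) * M' i)) =>
      (⟨blk (ℓ + 1) y.1, blk_mem_boxDom (by omega) y.2⟩ : ↥(boxDom M')) ∈ B) := by
  intro y hy y' hyy'
  simp only [Finset.mem_filter, Finset.mem_univ, true_and] at hy ⊢
  have : (⟨blk (ℓ + 1) y'.1, blk_mem_boxDom (by omega) y'.2⟩ : ↥(boxDom M'))
      = ⟨blk (ℓ + 1) y.1, blk_mem_boxDom (by omega) y.2⟩ := Subtype.ext hyy'
  rw [this]
  exact hy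

/-! ## §3 The entries of the two-level operator: level `j` outside `Λ`, level `j + 1` (factor `L^{−2}`) on `Λ` -/

/-- entries of `indBΛᵀ·W·indBΛ`: `[blk x ∈ Λ][blk x′ ∈ Λ]·W(blk x, blk x′)` (the matrix of `Q_j^*1_ΛW1_ΛQ_j·n^{d+1}`).
[cite: Balaban1984PropagatorsII, (2.40)–(2.41) p.230, dictionary] -/
theorem indBΛ_conj_apply {n : ℕ} (hn : 1 ≤ n) {M : Fin (d + 1) → ℕ} (Λ : Finset ↥(boxDom M))
    (W : Matrix ↥Λ ↥Λ ℝ) (x x' : ↥(boxDom (fun i => n * M i))) :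
    ((indBΛ n Λ)ᵀ * W * indBΛ n Λ) x x'
      = if h : ublk hn x ∈ Λ ∧ ublk hn x' ∈ Λ then W ⟨ublk hn x, h.1⟩ ⟨ublk hn x', h.2⟩ else 0 := by
  have hne : ∀ (z : ↥(boxDom (fun i => n * M i))) (y : ↥Λ), blk n z.1 ≠ y.1.1 → indBΛ n Λ y z = 0 :=
    fun z y h => by rw [indBΛ_apply, if_neg h]
  have heq : ∀ (z : ↥(boxDom (fun i => n * M i))) (h : ublk hn z ∈ Λ), indBΛ n Λ ⟨ublk hn z, h⟩ z = 1 :=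
    fun z h => by rw [indBΛ_apply]; exact if_pos rfl
  have hrow : ∀ y' : ↥Λ, ((indBΛ n Λ)ᵀ * W) x y' = if h : ublk hn x ∈ Λ then W ⟨ublk hn x, h⟩ y' else 0 := by
    intro y'
    rw [Matrix.mul_apply]
    by_cases h : ublk hn x ∈ Λ
    · rw [dif_pos h, Finset.sum_eq_single ⟨ublk hn x, h⟩]
      · rw [Matrix.transpose_apply, heq x h, one_mul]
      · intro y _ hy
        have hb : blk n x.1 ≠ y.1.1 := fun e => hy (Subtype.ext (Subtype.ext e.symm))
        rw [Matrix.transpose_apply, hne x y hb, zero_mul]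
      · intro habs; exact absurd (Finset.mem_univ _) habs
    · rw [dif_neg h]
      refine Finset.sum_eq_zero fun y _ => ?_
      have hb : blk n x.1 ≠ y.1.1 := by
        intro e
        have : ublk hn x = y.1 := Subtype.ext e
        exact h (this ▸ y.2)
      rw [Matrix.transpose_apply, hne x y hb, zero_mul]
  rw [Matrix.mul_apply]
  simp_rw [hrow]
  by_cases h : ublk hn x ∈ Λ
  · simp_rw [dif_pos h]
    by_cases h' : ublk hn x' ∈ Λ
    · rw [dif_pos ⟨h, h'⟩, Finset.sum_eq_single ⟨ublk hn x', h'⟩]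
      · rw [heq x' h', mul_one]
      · intro y _ hy
        have hb : blk n x'.1 ≠ y.1.1 := fun e => hy (Subtype.ext (Subtype.ext e.symm))
        rw [hne x' y hb, mul_zero]
      · intro habs; exact absurd (Finset.mem_univ _) habs
    · rw [dif_neg (fun hh => h' hh.2)]
      refine Finset.sum_eq_zero fun y _ => ?_
      have hb : blk n x'.1 ≠ y.1.1 := by
        intro e
        have : ublk hn x' = y.1 := Subtype.ext e
        exact h' (this ▸ y.2)
      rw [hne x' y hb, mul_zero]
  · simp_rw [dif_neg h, zero_mul, Finset.sum_const_zero]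
    rw [dif_neg (fun hh => h hh.1)]

/-- **THE ENTRIES OF THE GENUINE TWO-LEVEL CUBE OPERATOR** (`Λ` a union of `L`-blocks):
`D(x, x′) = n²(−Δ^N_X)(x, x′) + m²δ_{xx′} + { a_{j+1}L^{−2}(nL)^{−(d+1)}·[x, x′ in the same (j+1)-block]` if the
`j`-block of `x` lies in `Λ`;  `a_jn^{−(d+1)}·[x, x′ in the same j-block]` otherwise `}` — the matrix of
`−Δ^{ξ,N}_□ + m² + a_jQ_j^*Q_j` (level `j`) outside `Λ` and of `−Δ^{ξ,N}_□ + m² + a_{j+1}L^{−2}Q_{j+1}^*Q_{j+1}`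
(level `j + 1`, «the additional factor L^{−2}») on `Λ`, `ξ = 1/n = L^{−j}`.
[cite: Balaban1984PropagatorsII, (2.40)–(2.41) p.230 with (2.13)–(2.14) p.225] -/
theorem twoLevelOp_apply {n ℓ : ℕ} (hn : 1 ≤ n) (aj a m2 : ℝ) {M' : Fin (d + 1) → ℕ}
    {Λ : Finset ↥(boxDom (fun i => (ℓ + 1) * M' i))} (hΛ : IsBlockUnion ℓ M' Λ)
    (x x' : ↥(boxDom (fun i => n * ((ℓ + 1) * M' i)))) :
    twoLevelOp n ℓ aj a m2 M' Λ x x'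
      = (n : ℝ) ^ 2 * neumannLapK (fun i => n * ((ℓ + 1) * M' i)) x.1 x'.1 + diagK m2 x.1 x'.1
        + (if ublk hn x ∈ Λ then
            (if blk (n * (ℓ + 1)) x'.1 = blk (n * (ℓ + 1)) x.1 then
              aNext ℓ aj a / (((ℓ : ℝ) + 1)) ^ 2 * ((((n : ℝ) * ((ℓ : ℝ) + 1)) ^ (d + 1))⁻¹) else 0)
          else avgK (aj * ((n : ℝ) ^ (d + 1))⁻¹) n x.1 x'.1) := by
  have hL1 : 1 ≤ ℓ + 1 := by omega
  unfold twoLevelOp boxOpR opBoxR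
  rw [Matrix.sub_apply, Matrix.smul_apply, Matrix.of_apply, indBΛ_conj_apply hn, smul_eq_mul]
  have hbb : ∀ z : ↥(boxDom (fun i => n * ((ℓ + 1) * M' i))),
      blk (ℓ + 1) (ublk hn z).1 = blk (n * (ℓ + 1)) z.1 := fun z => blk_blk (ℓ + 1) n z.1
  by_cases h : ublk hn x ∈ Λ
  · rw [if_pos h]
    by_cases h' : ublk hn x' ∈ Λ
    · rw [dif_pos ⟨h, h'⟩, Matrix.sub_apply, Matrix.smul_apply, Matrix.smul_apply, Matrix.one_apply,
        smul_eq_mul, smul_eq_mul]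
      simp only [projΛ, Matrix.submatrix_apply, blockAvgP, Matrix.of_apply, avgK]
      rw [hbb x, hbb x']
      have hcase : (if (⟨ublk hn x, h⟩ : ↥Λ) = ⟨ublk hn x', h'⟩ then (1 : ℝ) else 0)
          = if blk n x'.1 = blk n x.1 then 1 else 0 := by
        by_cases e : blk n x'.1 = blk n x.1
        · rw [if_pos e, if_pos (Subtype.ext (Subtype.ext e.symm))]
        · rw [if_neg e, if_neg (fun hh => e (congrArg (fun z : ↥Λ => z.1.1) hh).symm)]
      rw [hcase]
      by_cases e : blk n x'.1 = blk n x.1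
      · rw [if_pos e, if_pos e]
        by_cases e2 : blk (n * (ℓ + 1)) x.1 = blk (n * (ℓ + 1)) x'.1
        · rw [if_pos e2, if_pos e2.symm]
          rw [mul_pow, mul_inv]
          ring
        · rw [if_neg e2, if_neg (fun hh => e2 hh.symm)]
          ring
      · rw [if_neg e, if_neg e]
        by_cases e2 : blk (n * (ℓ + 1)) x.1 = blk (n * (ℓ + 1)) x'.1
        · rw [if_pos e2, if_pos e2.symm]
          rw [mul_pow, mul_inv]
          ring
        · rw [if_neg e2, if_neg (fun hh => e2 hh.symm)]
          ring
    · rw [dif_neg (fun hh => h' hh.2), mul_zero, sub_zero]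
      have e : ¬ blk n x'.1 = blk n x.1 := by
        intro hh
        have : ublk hn x' = ublk hn x := Subtype.ext hh
        exact h' (this ▸ h)
      have e2 : ¬ blk (n * (ℓ + 1)) x'.1 = blk (n * (ℓ + 1)) x.1 := by
        intro hh
        rw [← hbb x, ← hbb x'] at hh
        exact h' (hΛ _ h _ hh)
      simp only [avgK, if_neg e, if_neg e2, add_zero]
  · rw [if_neg h, dif_neg (fun hh => h hh.1), mul_zero, sub_zero]
    ring

/-! ## §4 Weighted-row bookkeeping: monotonicity in the rate, submultiplicativity, the middle factor -/

section RowTools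

variable {N : Fin (d + 1) → ℕ}

/-- the weighted row functional is monotone in the rate (bookkeeping for (2.43)).
[cite: Balaban1984PropagatorsII, (2.43) p.230, bookkeeping] -/
theorem roww_mono {δ δ' : ℝ} (h : δ' ≤ δ) (n : ℕ) (T : Matrix ↥(boxDom N) ↥(boxDom N) ℝ) (x : ↥(boxDom N)) :
    roww δ' n T x ≤ roww δ n T x := by
  unfold roww
  refine Finset.sum_le_sum fun x' _ => mul_le_mul_of_nonneg_left ?_ (abs_nonneg _)
  exact Real.exp_le_exp.2 (div_le_div_of_nonneg_right
    (mul_le_mul_of_nonneg_right h (supNorm_nonneg _)) (Nat.cast_nonneg n))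

/-- **SUBMULTIPLICATIVITY** of the weighted row functional (triangle inequality for `|·|_∞`):
`roww(AB)(x) ≤ roww(A)(x) · sup_{x′} roww(B)(x′)` — the composition step of «From these and (2.42) we get (2.43)».
[cite: Balaban1984PropagatorsII, (2.43) p.230, bookkeeping] -/
theorem roww_mul_le {δ : ℝ} (hδ : 0 ≤ δ) (n : ℕ) (A B : Matrix ↥(boxDom N) ↥(boxDom N) ℝ) {R : ℝ}
    (hB : ∀ x', roww δ n B x' ≤ R) (x : ↥(boxDom N)) : roww δ n (A * B) x ≤ roww δ n A x * R := by
  unfold roww at hB ⊢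
  have hw : ∀ x' x'' : ↥(boxDom N), Real.exp (δ * supNorm (x.1 - x''.1) / n)
      ≤ Real.exp (δ * supNorm (x.1 - x'.1) / n) * Real.exp (δ * supNorm (x'.1 - x''.1) / n) := by
    intro x' x''
    rw [← Real.exp_add]
    apply Real.exp_le_exp.2
    rw [← add_div, ← mul_add]
    exact div_le_div_of_nonneg_right
      (mul_le_mul_of_nonneg_left (supNorm_sub_le_sub_add_sub _ _ _) hδ) (Nat.cast_nonneg n)
  calc ∑ x'', |(A * B) x x''| * Real.exp (δ * supNorm (x.1 - x''.1) / n)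
      ≤ ∑ x'', ∑ x', |A x x'| * Real.exp (δ * supNorm (x.1 - x'.1) / n)
          * (|B x' x''| * Real.exp (δ * supNorm (x'.1 - x''.1) / n)) := by
        refine Finset.sum_le_sum fun x'' _ => ?_
        rw [Matrix.mul_apply]
        calc |∑ x', A x x' * B x' x''| * Real.exp (δ * supNorm (x.1 - x''.1) / n)
            ≤ (∑ x', |A x x'| * |B x' x''|) * Real.exp (δ * supNorm (x.1 - x''.1) / n) := by
              refine mul_le_mul_of_nonneg_right ?_ (Real.exp_pos _).le
              exact (Finset.abs_sum_le_sum_abs _ _).trans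
                (le_of_eq (Finset.sum_congr rfl fun _ _ => abs_mul _ _))
          _ = ∑ x', |A x x'| * |B x' x''| * Real.exp (δ * supNorm (x.1 - x''.1) / n) :=
              Finset.sum_mul _ _ _
          _ ≤ _ := Finset.sum_le_sum fun x' _ => by
              calc |A x x'| * |B x' x''| * Real.exp (δ * supNorm (x.1 - x''.1) / n)
                  ≤ |A x x'| * |B x' x''| * (Real.exp (δ * supNorm (x.1 - x'.1) / n)
                      * Real.exp (δ * supNorm (x'.1 - x''.1) / n)) :=
                    mul_le_mul_of_nonneg_left (hw x' x'') (mul_nonneg (abs_nonneg _) (abs_nonneg _))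
                _ = _ := by ring
    _ = ∑ x', |A x x'| * Real.exp (δ * supNorm (x.1 - x'.1) / n)
          * ∑ x'', |B x' x''| * Real.exp (δ * supNorm (x'.1 - x''.1) / n) := by
        rw [Finset.sum_comm]
        exact Finset.sum_congr rfl fun x' _ => (Finset.mul_sum _ _ _).symm
    _ ≤ ∑ x', |A x x'| * Real.exp (δ * supNorm (x.1 - x'.1) / n) * R :=
        Finset.sum_le_sum fun x' _ =>
          mul_le_mul_of_nonneg_left (hB x') (mul_nonneg (abs_nonneg _) (Real.exp_pos _).le)
    _ = (∑ x', |A x x'| * Real.exp (δ * supNorm (x.1 - x'.1) / n)) * R := (Finset.sum_mul _ _ _).symm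

end RowTools

/-- **THE FIBRE SUM**: `Σ_{x′ ∈ X} e^{−t|blk x′ − y′|_∞} = n^{d+1}·Σ_{y″ ∈ □^{(j)}} e^{−t|y″ − y′|_∞} ≤ n^{d+1}K_{d+1}(t)`
(every `n`-block has `n^{d+1}` sites, `card_filter_blk`; lattice sum `rho_sumBound`).
[cite: Balaban1984PropagatorsII, (2.43) p.230, bookkeeping] -/
theorem fibre_sum_le {n : ℕ} (hn : 1 ≤ n) (M : Fin (d + 1) → ℕ) {t : ℝ} (ht : 0 < t) (y' : ↥(boxDom M)) :
    ∑ x' : ↥(boxDom (fun i => n * M i)), Real.exp (-(t * supNorm (blk n x'.1 - y'.1)))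
      ≤ ((n : ℝ)) ^ (d + 1) * latticeConst (d + 1) t := by
  have hmaps : ∀ z ∈ (Finset.univ : Finset ↥(boxDom (fun i => n * M i))),
      ublk hn z ∈ (Finset.univ : Finset ↥(boxDom M)) := fun _ _ => Finset.mem_univ _
  rw [← Finset.sum_fiberwise_of_maps_to hmaps]
  have hS := rho_sumBound M t ht y'
  have hfib : ∀ y'' : ↥(boxDom M),
      ∑ z ∈ Finset.univ.filter (fun z : ↥(boxDom (fun i => n * M i)) => ublk hn z = y''),
          Real.exp (-(t * supNorm (blk n z.1 - y'.1)))
        = ((n : ℝ)) ^ (d + 1) * Real.exp (-(t * rho M y' y'')) := by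
    intro y''
    rw [Finset.sum_congr rfl (g := fun _ => Real.exp (-(t * rho M y' y''))) fun z hz => by
      have hz' : blk n z.1 = y''.1 := congrArg Subtype.val (Finset.mem_filter.1 hz).2
      rw [hz']
      unfold rho
      rw [← B4TorusKernel.supNorm_neg, neg_sub]]
    rw [Finset.sum_const, nsmul_eq_mul]
    congr 1
    rw [← Nat.cast_pow, ← card_filter_blk hn M y'', Nat.cast_inj]
    exact congrArg Finset.card (Finset.filter_congr fun z _ => Subtype.ext_iff)
  rw [Finset.sum_congr rfl fun y'' _ => hfib y'', ← Finset.mul_sum]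
  exact mul_le_mul_of_nonneg_left hS (by positivity)

/-- **THE MIDDLE FACTOR**: if `|C(y, y′)| ≤ c·e^{−δ|y−y′|_∞}` on `Λ` and `0 ≤ δ′ ≤ δ/2`, then the fine-lattice kernel
`Q_j^*1_ΛC1_ΛQ_j·n^{d+1} = indBΛᵀ·C·indBΛ` has weighted rows `≤ c·e^{δ′}·n^{d+1}K_{d+1}(δ/2)` (points of two
`n`-blocks are at most `n(|β − β′|_∞ + 1)` apart, `supNorm_sub_le_blk`; the fibre sum).
[cite: Balaban1984PropagatorsII, (2.42)–(2.43) p.230 (the factor `G′_j(□)Q′_j*C_Λ^{(j)}(□)Q′_j`), bookkeeping] -/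
theorem roww_mid_le {n : ℕ} (hn : 1 ≤ n) {M : Fin (d + 1) → ℕ} (Λ : Finset ↥(boxDom M))
    {C : Matrix ↥Λ ↥Λ ℝ} {c δ δ' : ℝ} (hc : 0 ≤ c) (hδ : 0 < δ) (hδ'0 : 0 ≤ δ') (hδ' : δ' ≤ δ / 2)
    (hC : ∀ y y' : ↥Λ, |C y y'| ≤ c * Real.exp (-(δ * supNorm (y.1.1 - y'.1.1))))
    (x : ↥(boxDom (fun i => n * M i))) :
    roww δ' n ((indBΛ n Λ)ᵀ * C * indBΛ n Λ) x
      ≤ c * Real.exp δ' * (((n : ℝ)) ^ (d + 1) * latticeConst (d + 1) (δ / 2)) := by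
  unfold roww
  have hn' : (0 : ℝ) < n := by exact_mod_cast hn
  have hent : ∀ x' : ↥(boxDom (fun i => n * M i)), |((indBΛ n Λ)ᵀ * C * indBΛ n Λ) x x'|
      ≤ c * Real.exp (-(δ * supNorm (blk n x.1 - blk n x'.1))) := by
    intro x'
    rw [indBΛ_conj_apply hn]
    split_ifs with h
    · exact hC _ _
    · rw [abs_zero]; positivity
  have hwt : ∀ x' : ↥(boxDom (fun i => n * M i)), Real.exp (δ' * supNorm (x.1 - x'.1) / n)
      ≤ Real.exp δ' * Real.exp (δ' * supNorm (blk n x.1 - blk n x'.1)) := by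
    intro x'
    rw [← Real.exp_add]
    apply Real.exp_le_exp.2
    rw [div_le_iff₀ hn']
    have hb := mul_le_mul_of_nonneg_left (supNorm_sub_le_blk hn x.1 x'.1) hδ'0
    nlinarith [supNorm_nonneg (blk n x.1 - blk n x'.1)]
  calc ∑ x', |((indBΛ n Λ)ᵀ * C * indBΛ n Λ) x x'| * Real.exp (δ' * supNorm (x.1 - x'.1) / n)
      ≤ ∑ x' : ↥(boxDom (fun i => n * M i)), c * Real.exp (-(δ * supNorm (blk n x.1 - blk n x'.1)))
          * (Real.exp δ' * Real.exp (δ' * supNorm (blk n x.1 - blk n x'.1))) :=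
        Finset.sum_le_sum fun x' _ => mul_le_mul (hent x') (hwt x') (Real.exp_pos _).le (by positivity)
    _ ≤ ∑ x' : ↥(boxDom (fun i => n * M i)),
          c * Real.exp δ' * Real.exp (-(δ / 2 * supNorm (blk n x'.1 - (ublk hn x).1))) := by
        refine Finset.sum_le_sum fun x' _ => ?_
        have hs : supNorm (blk n x'.1 - (ublk hn x).1) = supNorm (blk n x.1 - blk n x'.1) := by
          show supNorm (blk n x'.1 - blk n x.1) = _
          rw [← B4TorusKernel.supNorm_neg, neg_sub]
        rw [hs, show c * Real.exp (-(δ * supNorm (blk n x.1 - blk n x'.1)))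
            * (Real.exp δ' * Real.exp (δ' * supNorm (blk n x.1 - blk n x'.1)))
            = c * Real.exp δ' * (Real.exp (-(δ * supNorm (blk n x.1 - blk n x'.1)))
              * Real.exp (δ' * supNorm (blk n x.1 - blk n x'.1))) by ring, ← Real.exp_add]
        refine mul_le_mul_of_nonneg_left (Real.exp_le_exp.2 ?_) (by positivity)
        nlinarith [supNorm_nonneg (blk n x.1 - blk n x'.1)]
    _ = c * Real.exp δ' * ∑ x' : ↥(boxDom (fun i => n * M i)),
          Real.exp (-(δ / 2 * supNorm (blk n x'.1 - (ublk hn x).1))) := by rw [Finset.mul_sum]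
    _ ≤ c * Real.exp δ' * (((n : ℝ)) ^ (d + 1) * latticeConst (d + 1) (δ / 2)) :=
        mul_le_mul_of_nonneg_left (fibre_sum_le hn M (half_pos hδ) (ublk hn x)) (by positivity)

/-! ## §5 (2.43)₁ for the genuine two-level `G′(□)`, uniformly in the mesh `L^{−j}` -/

/-- **THE DETERMINISTIC ASSEMBLY**: a weighted row bound `c₀` for `G_j(□)` at rate `δ₀` and the entry decay
`c·e^{−δ|y−y′|}` of `C_Λ^{(j)}(□)` give, for every `0 ≤ δ′ ≤ min(δ₀, δ/2)`,
`roww_{δ′}(G′(□))(x) ≤ c₀ + a_j²·c₀·(c e^{δ′}K_{d+1}(δ/2))·c₀` — «From these and (2.42) we get (2.43)».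
[cite: Balaban1984PropagatorsII, (2.42)–(2.43) p.230] -/
theorem gTwoLevel_roww_le {n ℓ : ℕ} (hn : 1 ≤ n) (aj a m2 : ℝ) {M' : Fin (d + 1) → ℕ}
    (Λ : Finset ↥(boxDom (fun i => (ℓ + 1) * M' i))) {δ₀ c₀ δ c δ' : ℝ}
    (hc₀ : 0 ≤ c₀) (hc : 0 ≤ c) (hδ : 0 < δ) (hδ'0 : 0 ≤ δ') (hδ'1 : δ' ≤ δ₀) (hδ'2 : δ' ≤ δ / 2)
    (hG : ∀ z, roww δ₀ n (boxOpR n aj m2 (fun i => (ℓ + 1) * M' i))⁻¹ z ≤ c₀)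
    (hC : ∀ y y' : ↥Λ, |cΛ n ℓ aj a m2 M' Λ y y'| ≤ c * Real.exp (-(δ * supNorm (y.1.1 - y'.1.1))))
    (x : ↥(boxDom (fun i => n * ((ℓ + 1) * M' i)))) :
    roww δ' n (gTwoLevel n ℓ aj a m2 M' Λ) x
      ≤ c₀ + aj ^ 2 * (c₀ * (c * Real.exp δ' * latticeConst (d + 1) (δ / 2)) * c₀) := by
  have hn' : (0 : ℝ) < n := by exact_mod_cast hn
  have hnD : (0 : ℝ) < ((n : ℝ)) ^ (d + 1) := by positivity
  have hGrow : ∀ z, roww δ' n (boxOpR n aj m2 (fun i => (ℓ + 1) * M' i))⁻¹ z ≤ c₀ :=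
    fun z => (roww_mono hδ'1 n _ z).trans (hG z)
  have hmid : ∀ z, roww δ' n ((indBΛ n Λ)ᵀ * cΛ n ℓ aj a m2 M' Λ * indBΛ n Λ) z
      ≤ c * Real.exp δ' * (((n : ℝ)) ^ (d + 1) * latticeConst (d + 1) (δ / 2)) :=
    fun z => roww_mid_le hn Λ hc hδ hδ'0 hδ'2 hC z
  have hK0 : 0 ≤ c * Real.exp δ' * (((n : ℝ)) ^ (d + 1) * latticeConst (d + 1) (δ / 2)) := by
    have := latticeConst_nonneg (d + 1) (half_pos hδ).le
    positivity
  have h3 : roww δ' n ((boxOpR n aj m2 (fun i => (ℓ + 1) * M' i))⁻¹ * (indBΛ n Λ)ᵀ * cΛ n ℓ aj a m2 M' Λ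
      * indBΛ n Λ * (boxOpR n aj m2 (fun i => (ℓ + 1) * M' i))⁻¹) x
      ≤ c₀ * (c * Real.exp δ' * (((n : ℝ)) ^ (d + 1) * latticeConst (d + 1) (δ / 2))) * c₀ := by
    rw [show (boxOpR n aj m2 (fun i => (ℓ + 1) * M' i))⁻¹ * (indBΛ n Λ)ᵀ * cΛ n ℓ aj a m2 M' Λ
        * indBΛ n Λ * (boxOpR n aj m2 (fun i => (ℓ + 1) * M' i))⁻¹
        = (boxOpR n aj m2 (fun i => (ℓ + 1) * M' i))⁻¹ * ((indBΛ n Λ)ᵀ * cΛ n ℓ aj a m2 M' Λ * indBΛ n Λ)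
          * (boxOpR n aj m2 (fun i => (ℓ + 1) * M' i))⁻¹ by simp only [Matrix.mul_assoc]]
    calc roww δ' n ((boxOpR n aj m2 (fun i => (ℓ + 1) * M' i))⁻¹
            * ((indBΛ n Λ)ᵀ * cΛ n ℓ aj a m2 M' Λ * indBΛ n Λ)
            * (boxOpR n aj m2 (fun i => (ℓ + 1) * M' i))⁻¹) x
        ≤ roww δ' n ((boxOpR n aj m2 (fun i => (ℓ + 1) * M' i))⁻¹
            * ((indBΛ n Λ)ᵀ * cΛ n ℓ aj a m2 M' Λ * indBΛ n Λ)) x * c₀ := roww_mul_le hδ'0 n _ _ hGrow x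
      _ ≤ roww δ' n (boxOpR n aj m2 (fun i => (ℓ + 1) * M' i))⁻¹ x
            * (c * Real.exp δ' * (((n : ℝ)) ^ (d + 1) * latticeConst (d + 1) (δ / 2))) * c₀ :=
          mul_le_mul_of_nonneg_right (roww_mul_le hδ'0 n _ _ hmid x) hc₀
      _ ≤ c₀ * (c * Real.exp δ' * (((n : ℝ)) ^ (d + 1) * latticeConst (d + 1) (δ / 2))) * c₀ :=
          mul_le_mul_of_nonneg_right (mul_le_mul_of_nonneg_right (hGrow x) hK0) hc₀
  unfold gTwoLevel
  calc roww δ' n ((boxOpR n aj m2 (fun i => (ℓ + 1) * M' i))⁻¹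
          + (aj ^ 2 * (((n : ℝ)) ^ (d + 1))⁻¹) •
            ((boxOpR n aj m2 (fun i => (ℓ + 1) * M' i))⁻¹ * (indBΛ n Λ)ᵀ * cΛ n ℓ aj a m2 M' Λ * indBΛ n Λ
              * (boxOpR n aj m2 (fun i => (ℓ + 1) * M' i))⁻¹)) x
      ≤ roww δ' n (boxOpR n aj m2 (fun i => (ℓ + 1) * M' i))⁻¹ x
          + roww δ' n ((aj ^ 2 * (((n : ℝ)) ^ (d + 1))⁻¹) •
            ((boxOpR n aj m2 (fun i => (ℓ + 1) * M' i))⁻¹ * (indBΛ n Λ)ᵀ * cΛ n ℓ aj a m2 M' Λ * indBΛ n Λ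
              * (boxOpR n aj m2 (fun i => (ℓ + 1) * M' i))⁻¹)) x := roww_add_le _ _ _ _ _
    _ ≤ c₀ + (aj ^ 2 * (((n : ℝ)) ^ (d + 1))⁻¹)
          * (c₀ * (c * Real.exp δ' * (((n : ℝ)) ^ (d + 1) * latticeConst (d + 1) (δ / 2))) * c₀) := by
        rw [roww_smul _ _ (by positivity)]
        exact add_le_add (hGrow x) (mul_le_mul_of_nonneg_left h3 (by positivity))
    _ = c₀ + aj ^ 2 * (c₀ * (c * Real.exp δ' * latticeConst (d + 1) (δ / 2)) * c₀) := by
        field_simp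

/-- **[B6] (2.43), FIRST QUANTITY, FOR THE GENUINE TWO-LEVEL CUBE PROPAGATOR `G′(□)`, UNIFORMLY IN THE MESH —
weighted-row form.**  For every dimension `d + 1`, block size `L = ℓ + 1 ≥ 2` and parameter window
(`a_j ∈ [a₋, a₊]`, `m² ∈ [0, m²₊]`, `a ∈ [a₂₋, a₂₊]`, `a₋, a₂₋ > 0`) there are `δ′, c′ > 0` such that for EVERY
`j ≥ 1` (mesh `L^{−j}`, `n = L^j` fine points per unit length), every point of the window, EVERY box `□` built of
`L`-blocks (unit box `Π[0, L·M′_μ)`) and EVERY `Λ ⊆ □^{(j)}`: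
`Σ_{x′ ∈ □} |G′(□; x, x′)|·e^{δ′·dist(x,x′)} ≤ c′`, `dist = |·|_∞/L^j` the sup-distance of the `L^{−j}`-lattice.
Inputs BY NAME: `B4Thm110ZeroBox.thm110_zero_box_roww_coeff` ([3] Theorem (1.10)/Lemma 2.2 at `A = 0` for boxes) for
`G_j(□)` and `B4BoxCov237.cov116_box_finset_decay` ([3] Proposition 2.3 (1.16), `Ω = □`, every `Λ`) for
`C_Λ^{(j)}(□)` — the printed route «Properties of the operators G′_j(□), G′_j(□)Q′_j* and C_Λ^{(j)}(□) are described
in Lemmas 2.2, 2.4, Proposition 2.3 [3]. From these and (2.42) we get (2.43)».  HONEST SCOPE: `A = 0`; the first of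
the two quantities of (2.43) (the derivative `∂^{L^{−j}}_μG′(□)` is not typed); constants depend on `d`, `ℓ` and the
window; the union-of-blocks structure of `Λ` is NOT needed for this estimate (it is needed for `G′(□)` to invert the
two-level operator, `twoLevelOp_mul_gTwoLevel`). [cite: Balaban1984PropagatorsII, (2.43) p.230] -/
theorem ineq243_twoLevel_roww (d ℓ : ℕ) (hℓ : 1 ≤ ℓ) (aminus aplus m2plus a2minus a2plus : ℝ) (ha : 0 < aminus)
    (ha2 : 0 < a2minus) :
    ∃ δ' c' : ℝ, 0 < δ' ∧ 0 < c' ∧ ∀ (k : ℕ), 1 ≤ k → ∀ (aj m2 a : ℝ), aminus ≤ aj → aj ≤ aplus → 0 ≤ m2 →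
      m2 ≤ m2plus → a2minus ≤ a → a ≤ a2plus → ∀ (M' : Fin (d + 1) → ℕ), (∀ i, 1 ≤ M' i) →
        ∀ (Λ : Finset ↥(boxDom (fun i => (ℓ + 1) * M' i)))
          (x : ↥(boxDom (fun i => (ℓ + 1) ^ k * ((ℓ + 1) * M' i)))),
          roww δ' ((ℓ + 1) ^ k) (gTwoLevel ((ℓ + 1) ^ k) ℓ aj a m2 M' Λ) x ≤ c' := by
  obtain ⟨δ₀, c₀, hδ₀, hc₀, hG⟩ := thm110_zero_box_roww_coeff d ℓ hℓ aminus aplus m2plus ha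
  obtain ⟨δ, c, hδ, hc, hC⟩ := cov116_box_finset_decay d ℓ hℓ aminus aplus m2plus a2minus a2plus ha ha2
  have hδ'pos : 0 < min δ₀ (δ / 2) := lt_min hδ₀ (half_pos hδ)
  have hKn : 0 ≤ latticeConst (d + 1) (δ / 2) := latticeConst_nonneg (d + 1) (half_pos hδ).le
  refine ⟨min δ₀ (δ / 2), c₀ + aplus ^ 2 * (c₀ * (c * Real.exp (min δ₀ (δ / 2)) * latticeConst (d + 1) (δ / 2))
    * c₀), hδ'pos, by positivity, ?_⟩
  intro k hk aj m2 a h1 h2 h3 h4 h5 h6 M' hM Λ x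
  have hn1 : 1 ≤ (ℓ + 1) ^ k := Nat.one_le_pow _ _ (by omega)
  have hMℓ : ∀ i, 1 ≤ (ℓ + 1) * M' i := fun i => by nlinarith [hM i]
  have haj : 0 < aj := lt_of_lt_of_le ha h1
  have hGz : ∀ z, roww δ₀ ((ℓ + 1) ^ k) (boxOpR ((ℓ + 1) ^ k) aj m2 (fun i => (ℓ + 1) * M' i))⁻¹ z ≤ c₀ :=
    fun z => hG k hk aj m2 h1 h2 h3 h4 (fun i => (ℓ + 1) * M' i) hMℓ z
  have hCz := (hC ((ℓ + 1) ^ k) hn1 aj m2 a h1 h2 h3 h4 h5 h6 M' hM Λ).2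
  calc roww (min δ₀ (δ / 2)) ((ℓ + 1) ^ k) (gTwoLevel ((ℓ + 1) ^ k) ℓ aj a m2 M' Λ) x
      ≤ c₀ + aj ^ 2 * (c₀ * (c * Real.exp (min δ₀ (δ / 2)) * latticeConst (d + 1) (δ / 2)) * c₀) :=
        gTwoLevel_roww_le hn1 aj a m2 Λ hc₀.le hc.le hδ hδ'pos.le (min_le_left _ _) (min_le_right _ _) hGz hCz x
    _ ≤ c₀ + aplus ^ 2 * (c₀ * (c * Real.exp (min δ₀ (δ / 2)) * latticeConst (d + 1) (δ / 2)) * c₀) := by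
        have : aj ^ 2 ≤ aplus ^ 2 := pow_le_pow_left₀ haj.le h2 2
        have h0 : 0 ≤ c₀ * (c * Real.exp (min δ₀ (δ / 2)) * latticeConst (d + 1) (δ / 2)) * c₀ := by positivity
        nlinarith

/-- **[B6] (2.43), FIRST QUANTITY — THE PRINTED VALUE CLAUSE** `|(G′(□)λ)(x)| ≤ O(1)e^{−δ₀dist(x, supp λ)}|λ|`
for the genuine two-level cube propagator, uniformly in the mesh: with the constants of `ineq243_twoLevel_roww`, for
every `λ : □ → ℝ`, every bound `F ≥ |λ|` and every `D ≤ |x − x′|_∞` on `supp λ` (fine-lattice units, so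
`D/L^j ≤ dist(x, supp λ)` on the `L^{−j}`-scale):  `|(G′(□)λ)(x)| ≤ c′e^{−δ′D/L^j}F`.
[cite: Balaban1984PropagatorsII, (2.43) p.230] -/
theorem ineq243_twoLevel_value (d ℓ : ℕ) (hℓ : 1 ≤ ℓ) (aminus aplus m2plus a2minus a2plus : ℝ) (ha : 0 < aminus)
    (ha2 : 0 < a2minus) :
    ∃ δ' c' : ℝ, 0 < δ' ∧ 0 < c' ∧ ∀ (k : ℕ), 1 ≤ k → ∀ (aj m2 a : ℝ), aminus ≤ aj → aj ≤ aplus → 0 ≤ m2 →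
      m2 ≤ m2plus → a2minus ≤ a → a ≤ a2plus → ∀ (M' : Fin (d + 1) → ℕ), (∀ i, 1 ≤ M' i) →
        ∀ (Λ : Finset ↥(boxDom (fun i => (ℓ + 1) * M' i)))
          (f : ↥(boxDom (fun i => (ℓ + 1) ^ k * ((ℓ + 1) * M' i))) → ℝ) (F D : ℝ), (∀ x', |f x'| ≤ F) →
          ∀ x : ↥(boxDom (fun i => (ℓ + 1) ^ k * ((ℓ + 1) * M' i))),
            (∀ x', f x' ≠ 0 → D ≤ supNorm (x.1 - x'.1)) →
              |(gTwoLevel ((ℓ + 1) ^ k) ℓ aj a m2 M' Λ *ᵥ f) x|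
                ≤ c' * Real.exp (-(δ' * D / (((ℓ + 1) ^ k : ℕ) : ℝ))) * F := by
  obtain ⟨δ', c', hδ', hc', h⟩ := ineq243_twoLevel_roww d ℓ hℓ aminus aplus m2plus a2minus a2plus ha ha2
  refine ⟨δ', c', hδ', hc', ?_⟩
  intro k hk aj m2 a h1 h2 h3 h4 h5 h6 M' hM Λ f F D hF x hD
  exact mulVec_le_of_roww hδ'.le _ _ x (h k hk aj m2 a h1 h2 h3 h4 h5 h6 M' hM Λ x) f hF hD

/-- **THE SAME WITH THE LITERAL `dist(x, supp λ)`** (`dsupp f x`, fine-lattice units):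
`|(G′(□)λ)(x)| ≤ c′e^{−δ′·dsupp/L^j}·F`. [cite: Balaban1984PropagatorsII, (2.43) p.230] -/
theorem ineq243_twoLevel_dist (d ℓ : ℕ) (hℓ : 1 ≤ ℓ) (aminus aplus m2plus a2minus a2plus : ℝ) (ha : 0 < aminus)
    (ha2 : 0 < a2minus) :
    ∃ δ' c' : ℝ, 0 < δ' ∧ 0 < c' ∧ ∀ (k : ℕ), 1 ≤ k → ∀ (aj m2 a : ℝ), aminus ≤ aj → aj ≤ aplus → 0 ≤ m2 →
      m2 ≤ m2plus → a2minus ≤ a → a ≤ a2plus → ∀ (M' : Fin (d + 1) → ℕ), (∀ i, 1 ≤ M' i) →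
        ∀ (Λ : Finset ↥(boxDom (fun i => (ℓ + 1) * M' i)))
          (f : ↥(boxDom (fun i => (ℓ + 1) ^ k * ((ℓ + 1) * M' i))) → ℝ) (F : ℝ), (∀ x', |f x'| ≤ F) →
          ∀ x : ↥(boxDom (fun i => (ℓ + 1) ^ k * ((ℓ + 1) * M' i))),
            |(gTwoLevel ((ℓ + 1) ^ k) ℓ aj a m2 M' Λ *ᵥ f) x|
              ≤ c' * Real.exp (-(δ' * dsupp f x / (((ℓ + 1) ^ k : ℕ) : ℝ))) * F := by
  obtain ⟨δ', c', hδ', hc', h⟩ := ineq243_twoLevel_value d ℓ hℓ aminus aplus m2plus a2minus a2plus ha ha2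
  refine ⟨δ', c', hδ', hc', ?_⟩
  intro k hk aj m2 a h1 h2 h3 h4 h5 h6 M' hM Λ f F hF x
  exact h k hk aj m2 a h1 h2 h3 h4 h5 h6 M' hM Λ f F (dsupp f x) hF x fun x' hx' => dsupp_le f x x' hx'

/-- **(2.43)₁ ALONG BAŁABAN'S SEQUENCE `a_j = B1.aSeq a L j`** (the running constants of (2.13), so that the
level-`(j+1)` coefficient of the two-level operator is literally `a_{j+1} = B1.aSeq a L (j+1)`, `aNext_aSeq`): for
`a ∈ [a₂₋, a₂₊]`, `m² ∈ [0, m²₊]`, every `j ≥ 1`, every box, every `Λ`, every `λ`: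
`|(G′(□)λ)(x)| ≤ c′e^{−δ′D/L^j}F`. [cite: Balaban1984PropagatorsII, (2.43) p.230 with (2.13) p.225] -/
theorem ineq243_twoLevel_value_aSeq (d ℓ : ℕ) (hℓ : 1 ≤ ℓ) (m2plus a2minus a2plus : ℝ) (ha2 : 0 < a2minus) :
    ∃ δ' c' : ℝ, 0 < δ' ∧ 0 < c' ∧ ∀ (k : ℕ), 1 ≤ k → ∀ (m2 a : ℝ), 0 ≤ m2 → m2 ≤ m2plus → a2minus ≤ a →
      a ≤ a2plus → ∀ (M' : Fin (d + 1) → ℕ), (∀ i, 1 ≤ M' i) →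
        ∀ (Λ : Finset ↥(boxDom (fun i => (ℓ + 1) * M' i)))
          (f : ↥(boxDom (fun i => (ℓ + 1) ^ k * ((ℓ + 1) * M' i))) → ℝ) (F D : ℝ), (∀ x', |f x'| ≤ F) →
          ∀ x : ↥(boxDom (fun i => (ℓ + 1) ^ k * ((ℓ + 1) * M' i))),
            (∀ x', f x' ≠ 0 → D ≤ supNorm (x.1 - x'.1)) →
              |(gTwoLevel ((ℓ + 1) ^ k) ℓ (B1.aSeq a ((ℓ : ℝ) + 1) k) a m2 M' Λ *ᵥ f) x|
                ≤ c' * Real.exp (-(δ' * D / (((ℓ + 1) ^ k : ℕ) : ℝ))) * F := by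
  obtain ⟨δ', c', hδ', hc', h⟩ := ineq243_twoLevel_value d ℓ hℓ
    (a2minus * (1 - ((((ℓ : ℝ) + 1)) ^ 2)⁻¹)) a2plus m2plus a2minus a2plus (aminus'_pos hℓ ha2) ha2
  refine ⟨δ', c', hδ', hc', ?_⟩
  intro k hk m2 a h3 h4 h5 h6 M' hM Λ f F D hF x hD
  obtain ⟨w1, w2, -⟩ := aSeq_window hℓ ha2 h5 h6 hk
  exact h k hk _ m2 a w1 w2 h3 h4 h5 h6 M' hM Λ f F D hF x hD

/-! ## §6 Non-vacuity (`d + 1 = 4`, `L = 2`, windows `a_j ∈ [1/2, 2]`, `m² ∈ [0, 1]`, `a ∈ [1/2, 2]`) -/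

/-- the main estimate at the physical dimension `d + 1 = 4`, `L = 2`. -/
example : ∃ δ' c' : ℝ, 0 < δ' ∧ 0 < c' ∧ ∀ (k : ℕ), 1 ≤ k → ∀ (aj m2 a : ℝ), (1 / 2 : ℝ) ≤ aj → aj ≤ 2 →
    0 ≤ m2 → m2 ≤ 1 → (1 / 2 : ℝ) ≤ a → a ≤ 2 → ∀ (M' : Fin (3 + 1) → ℕ), (∀ i, 1 ≤ M' i) →
      ∀ (Λ : Finset ↥(boxDom (fun i => (1 + 1) * M' i)))
        (x : ↥(boxDom (fun i => (1 + 1) ^ k * ((1 + 1) * M' i)))),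
        roww δ' ((1 + 1) ^ k) (gTwoLevel ((1 + 1) ^ k) 1 aj a m2 M' Λ) x ≤ c' :=
  ineq243_twoLevel_roww 3 1 le_rfl (1 / 2) 2 1 (1 / 2) 2 (by norm_num) (by norm_num)

/-- the Woodbury inversion is non-vacuous: `n = 2` (`j = 1`), `L = 2`, `a_1 = a = 1`, `m² = 0`, the unit cube of
blocks `M′ ≡ 1`, `Λ` = the whole unit box (a union of `L`-blocks: all of them). -/
example : twoLevelOp 2 1 (1 : ℝ) 1 0 (fun _ : Fin (3 + 1) => 1) Finset.univ
    * gTwoLevel 2 1 (1 : ℝ) 1 0 (fun _ : Fin (3 + 1) => 1) Finset.univ = 1 :=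
  twoLevelOp_mul_gTwoLevel (by norm_num) le_rfl one_pos one_pos le_rfl (fun _ => le_rfl)
    (fun _ _ y' _ => Finset.mem_univ y')


/-! ## §7 (2.43)₂: the derivative `∂^{L^{−j}}_μG′(□)` — the differenced rows of `G′(□)`, uniformly in the mesh -/

section DerivTools

open Literature.MathematicalPhysics.QuantumFieldTheory.Balaban1983to89.B4Thm110ZeroBoxDeriv (wsum)

variable {N : Fin (d + 1) → ℕ}

/-- the weighted functional of a vector about `x` is monotone in the rate (bookkeeping for (2.43)).
[cite: Balaban1984PropagatorsII, (2.43) p.230, bookkeeping] -/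
theorem wsum_mono {δ δ' : ℝ} (h : δ' ≤ δ) (n : ℕ) (x : ↥(boxDom N)) (g : ↥(boxDom N) → ℝ) :
    wsum δ' n x g ≤ wsum δ n x g := by
  unfold wsum
  refine Finset.sum_le_sum fun x' _ => mul_le_mul_of_nonneg_left ?_ (abs_nonneg _)
  exact Real.exp_le_exp.2 (div_le_div_of_nonneg_right
    (mul_le_mul_of_nonneg_right h (supNorm_nonneg _)) (Nat.cast_nonneg n))

/-- **VECTOR–MATRIX SUBMULTIPLICATIVITY** of the weighted functionals: for a vector `g` about `x` and a kernel `B`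
with weighted rows `≤ R`, `wsum_x(g·B) ≤ wsum_x(g)·R` (triangle inequality for `|·|_∞`).
[cite: Balaban1984PropagatorsII, (2.43) p.230, bookkeeping] -/
theorem wsum_vecMul_le {δ : ℝ} (hδ : 0 ≤ δ) (n : ℕ) (x : ↥(boxDom N)) (g : ↥(boxDom N) → ℝ)
    (B : Matrix ↥(boxDom N) ↥(boxDom N) ℝ) {R : ℝ} (hB : ∀ x', roww δ n B x' ≤ R) :
    wsum δ n x (fun x'' => ∑ x', g x' * B x' x'') ≤ wsum δ n x g * R := by
  unfold wsum
  unfold roww at hB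
  have hw : ∀ x' x'' : ↥(boxDom N), Real.exp (δ * supNorm (x.1 - x''.1) / n)
      ≤ Real.exp (δ * supNorm (x.1 - x'.1) / n) * Real.exp (δ * supNorm (x'.1 - x''.1) / n) := by
    intro x' x''
    rw [← Real.exp_add]
    apply Real.exp_le_exp.2
    rw [← add_div, ← mul_add]
    exact div_le_div_of_nonneg_right
      (mul_le_mul_of_nonneg_left (supNorm_sub_le_sub_add_sub _ _ _) hδ) (Nat.cast_nonneg n)
  calc ∑ x'', |∑ x', g x' * B x' x''| * Real.exp (δ * supNorm (x.1 - x''.1) / n)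
      ≤ ∑ x'', ∑ x', |g x'| * Real.exp (δ * supNorm (x.1 - x'.1) / n)
          * (|B x' x''| * Real.exp (δ * supNorm (x'.1 - x''.1) / n)) := by
        refine Finset.sum_le_sum fun x'' _ => ?_
        calc |∑ x', g x' * B x' x''| * Real.exp (δ * supNorm (x.1 - x''.1) / n)
            ≤ (∑ x', |g x'| * |B x' x''|) * Real.exp (δ * supNorm (x.1 - x''.1) / n) := by
              refine mul_le_mul_of_nonneg_right ?_ (Real.exp_pos _).le
              exact (Finset.abs_sum_le_sum_abs _ _).trans
                (le_of_eq (Finset.sum_congr rfl fun _ _ => abs_mul _ _))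
          _ = ∑ x', |g x'| * |B x' x''| * Real.exp (δ * supNorm (x.1 - x''.1) / n) := Finset.sum_mul _ _ _
          _ ≤ _ := Finset.sum_le_sum fun x' _ => by
              calc |g x'| * |B x' x''| * Real.exp (δ * supNorm (x.1 - x''.1) / n)
                  ≤ |g x'| * |B x' x''| * (Real.exp (δ * supNorm (x.1 - x'.1) / n)
                      * Real.exp (δ * supNorm (x'.1 - x''.1) / n)) :=
                    mul_le_mul_of_nonneg_left (hw x' x'') (mul_nonneg (abs_nonneg _) (abs_nonneg _))
                _ = _ := by ring
    _ = ∑ x', |g x'| * Real.exp (δ * supNorm (x.1 - x'.1) / n)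
          * ∑ x'', |B x' x''| * Real.exp (δ * supNorm (x'.1 - x''.1) / n) := by
        rw [Finset.sum_comm]
        exact Finset.sum_congr rfl fun x' _ => (Finset.mul_sum _ _ _).symm
    _ ≤ ∑ x', |g x'| * Real.exp (δ * supNorm (x.1 - x'.1) / n) * R :=
        Finset.sum_le_sum fun x' _ =>
          mul_le_mul_of_nonneg_left (hB x') (mul_nonneg (abs_nonneg _) (Real.exp_pos _).le)
    _ = (∑ x', |g x'| * Real.exp (δ * supNorm (x.1 - x'.1) / n)) * R := (Finset.sum_mul _ _ _).symm

/-- differencing the rows of `G + c·G·B` between two points: `t((G + cGB)(p,·) − (G + cGB)(q,·)) =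
t(G(p,·) − G(q,·)) + c·(t(G(p,·) − G(q,·)))·B`. [cite: Balaban1984PropagatorsII, (2.42)–(2.43) p.230, bookkeeping] -/
theorem row_sub_add_smul_mul (G B : Matrix ↥(boxDom N) ↥(boxDom N) ℝ) (c t : ℝ) (p q x'' : ↥(boxDom N)) :
    t * ((G + c • (G * B)) p x'' - (G + c • (G * B)) q x'')
      = t * (G p x'' - G q x'') + c * ∑ x', t * (G p x' - G q x') * B x' x'' := by
  simp only [Matrix.add_apply, Matrix.smul_apply, Matrix.mul_apply, smul_eq_mul]
  rw [show ∑ x', t * (G p x' - G q x') * B x' x'' = t * (∑ x', G p x' * B x' x'' - ∑ x', G q x' * B x' x'') by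
    rw [← Finset.sum_sub_distrib, Finset.mul_sum]
    exact Finset.sum_congr rfl fun x' _ => by ring]
  ring

end DerivTools

open Literature.MathematicalPhysics.QuantumFieldTheory.Balaban1983to89.B4Thm110ZeroBoxDeriv
  (wsum wsum_add_le wsum_mul_left abs_sum_mul_le_of_wsum mulVec_sub_mulVec thm110_zero_box_deriv_roww_coeff)

/-- **THE DETERMINISTIC ASSEMBLY, DERIVATIVE**: a weighted row bound `c₀` for `G_j(□)` (rate `δ₀`), a weighted bound
`c₁` for the differenced row `n(G_j(□)(xe,·) − G_j(□)(x,·))` about `x` (rate `δ₁`) and the entry decay of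
`C_Λ^{(j)}(□)` (rate `δ`, constant `c`) give, for `0 ≤ δ′ ≤ min(δ₀, δ₁, δ/2)`,
`wsum_{δ′,x}(n(G′(□)(xe,·) − G′(□)(x,·))) ≤ c₁ + a_j²·c₁(ce^{δ′}K_{d+1}(δ/2))c₀`.
[cite: Balaban1984PropagatorsII, (2.42)–(2.43) p.230] -/
theorem gTwoLevel_deriv_wsum_le {n ℓ : ℕ} (hn : 1 ≤ n) (aj a m2 : ℝ) {M' : Fin (d + 1) → ℕ}
    (Λ : Finset ↥(boxDom (fun i => (ℓ + 1) * M' i))) {δ₀ c₀ δ₁ c₁ δ c δ' : ℝ}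
    (hc₀ : 0 ≤ c₀) (hc : 0 ≤ c) (hδ : 0 < δ) (hδ'0 : 0 ≤ δ') (hδ'1 : δ' ≤ δ₀) (hδ'3 : δ' ≤ δ₁)
    (hδ'2 : δ' ≤ δ / 2)
    (hG : ∀ z, roww δ₀ n (boxOpR n aj m2 (fun i => (ℓ + 1) * M' i))⁻¹ z ≤ c₀)
    (hC : ∀ y y' : ↥Λ, |cΛ n ℓ aj a m2 M' Λ y y'| ≤ c * Real.exp (-(δ * supNorm (y.1.1 - y'.1.1))))
    (x xe : ↥(boxDom (fun i => n * ((ℓ + 1) * M' i))))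
    (hD : wsum δ₁ n x (fun x' => (n : ℝ) * ((boxOpR n aj m2 (fun i => (ℓ + 1) * M' i))⁻¹ xe x'
        - (boxOpR n aj m2 (fun i => (ℓ + 1) * M' i))⁻¹ x x')) ≤ c₁) :
    wsum δ' n x (fun x' => (n : ℝ) * (gTwoLevel n ℓ aj a m2 M' Λ xe x' - gTwoLevel n ℓ aj a m2 M' Λ x x'))
      ≤ c₁ + aj ^ 2 * (c₁ * (c * Real.exp δ' * latticeConst (d + 1) (δ / 2)) * c₀) := by
  have hn' : (0 : ℝ) < n := by exact_mod_cast hn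
  have hnD : (0 : ℝ) < ((n : ℝ)) ^ (d + 1) := by positivity
  have hc₁ : 0 ≤ c₁ := (B4Thm110ZeroBoxDeriv.wsum_nonneg _ _ _ _).trans hD
  have hGrow : ∀ z, roww δ' n (boxOpR n aj m2 (fun i => (ℓ + 1) * M' i))⁻¹ z ≤ c₀ :=
    fun z => (roww_mono hδ'1 n _ z).trans (hG z)
  have hmid : ∀ z, roww δ' n ((indBΛ n Λ)ᵀ * cΛ n ℓ aj a m2 M' Λ * indBΛ n Λ) z
      ≤ c * Real.exp δ' * (((n : ℝ)) ^ (d + 1) * latticeConst (d + 1) (δ / 2)) :=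
    fun z => roww_mid_le hn Λ hc hδ hδ'0 hδ'2 hC z
  have hK0 : 0 ≤ c * Real.exp δ' * (((n : ℝ)) ^ (d + 1) * latticeConst (d + 1) (δ / 2)) := by
    have := latticeConst_nonneg (d + 1) (half_pos hδ).le
    positivity
  have hMG : ∀ z, roww δ' n ((indBΛ n Λ)ᵀ * cΛ n ℓ aj a m2 M' Λ * indBΛ n Λ
      * (boxOpR n aj m2 (fun i => (ℓ + 1) * M' i))⁻¹) z
      ≤ c * Real.exp δ' * (((n : ℝ)) ^ (d + 1) * latticeConst (d + 1) (δ / 2)) * c₀ :=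
    fun z => (roww_mul_le hδ'0 n _ _ hGrow z).trans (mul_le_mul_of_nonneg_right (hmid z) hc₀)
  have hD' : wsum δ' n x (fun x' => (n : ℝ) * ((boxOpR n aj m2 (fun i => (ℓ + 1) * M' i))⁻¹ xe x'
      - (boxOpR n aj m2 (fun i => (ℓ + 1) * M' i))⁻¹ x x')) ≤ c₁ := (wsum_mono hδ'3 n x _).trans hD
  have hassoc : gTwoLevel n ℓ aj a m2 M' Λ = (boxOpR n aj m2 (fun i => (ℓ + 1) * M' i))⁻¹
      + (aj ^ 2 * (((n : ℝ)) ^ (d + 1))⁻¹) • ((boxOpR n aj m2 (fun i => (ℓ + 1) * M' i))⁻¹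
        * ((indBΛ n Λ)ᵀ * cΛ n ℓ aj a m2 M' Λ * indBΛ n Λ * (boxOpR n aj m2 (fun i => (ℓ + 1) * M' i))⁻¹)) := by
    unfold gTwoLevel
    simp only [Matrix.mul_assoc]
  simp_rw [hassoc, row_sub_add_smul_mul]
  calc wsum δ' n x (fun x'' => (n : ℝ) * ((boxOpR n aj m2 (fun i => (ℓ + 1) * M' i))⁻¹ xe x''
          - (boxOpR n aj m2 (fun i => (ℓ + 1) * M' i))⁻¹ x x'')
          + aj ^ 2 * (((n : ℝ)) ^ (d + 1))⁻¹ * ∑ x', (n : ℝ) * ((boxOpR n aj m2 (fun i => (ℓ + 1) * M' i))⁻¹ xe x'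
            - (boxOpR n aj m2 (fun i => (ℓ + 1) * M' i))⁻¹ x x')
            * ((indBΛ n Λ)ᵀ * cΛ n ℓ aj a m2 M' Λ * indBΛ n Λ * (boxOpR n aj m2 (fun i => (ℓ + 1) * M' i))⁻¹)
              x' x'')
      ≤ wsum δ' n x (fun x'' => (n : ℝ) * ((boxOpR n aj m2 (fun i => (ℓ + 1) * M' i))⁻¹ xe x''
          - (boxOpR n aj m2 (fun i => (ℓ + 1) * M' i))⁻¹ x x''))
        + wsum δ' n x (fun x'' => aj ^ 2 * (((n : ℝ)) ^ (d + 1))⁻¹ * ∑ x', (n : ℝ)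
            * ((boxOpR n aj m2 (fun i => (ℓ + 1) * M' i))⁻¹ xe x' - (boxOpR n aj m2 (fun i => (ℓ + 1) * M' i))⁻¹ x x')
            * ((indBΛ n Λ)ᵀ * cΛ n ℓ aj a m2 M' Λ * indBΛ n Λ * (boxOpR n aj m2 (fun i => (ℓ + 1) * M' i))⁻¹)
              x' x'') := wsum_add_le _ _ _ _ _
    _ ≤ c₁ + aj ^ 2 * (((n : ℝ)) ^ (d + 1))⁻¹
        * (c₁ * (c * Real.exp δ' * (((n : ℝ)) ^ (d + 1) * latticeConst (d + 1) (δ / 2)) * c₀)) := by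
        have h2nd : wsum δ' n x (fun x'' => aj ^ 2 * (((n : ℝ)) ^ (d + 1))⁻¹ * ∑ x', (n : ℝ)
            * ((boxOpR n aj m2 (fun i => (ℓ + 1) * M' i))⁻¹ xe x' - (boxOpR n aj m2 (fun i => (ℓ + 1) * M' i))⁻¹ x x')
            * ((indBΛ n Λ)ᵀ * cΛ n ℓ aj a m2 M' Λ * indBΛ n Λ * (boxOpR n aj m2 (fun i => (ℓ + 1) * M' i))⁻¹)
              x' x'')
            ≤ aj ^ 2 * (((n : ℝ)) ^ (d + 1))⁻¹
              * (c₁ * (c * Real.exp δ' * (((n : ℝ)) ^ (d + 1) * latticeConst (d + 1) (δ / 2)) * c₀)) := by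
          rw [wsum_mul_left _ _ _ (by positivity)]
          exact mul_le_mul_of_nonneg_left
            ((wsum_vecMul_le hδ'0 n x _ _ hMG).trans (mul_le_mul_of_nonneg_right hD' (mul_nonneg hK0 hc₀)))
            (by positivity)
        exact add_le_add hD' h2nd
    _ = c₁ + aj ^ 2 * (c₁ * (c * Real.exp δ' * latticeConst (d + 1) (δ / 2)) * c₀) := by
        field_simp

/-- **[B6] (2.43), SECOND QUANTITY `∂^{L^{−j}}_μG′(□)`, FOR THE GENUINE TWO-LEVEL CUBE PROPAGATOR, UNIFORMLY IN THE
MESH — weighted form.**  For every dimension, block size and window there are `δ′, c′ > 0` such that for EVERY `j ≥ 1`,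
every point of the window, every box built of `L`-blocks, EVERY `Λ ⊆ □^{(j)}`, every axis `μ` and every pair of
fine-lattice neighbours `x, xe = x + ξe_μ` of `□`:
`Σ_{x′ ∈ □} |ξ^{−1}(G′(□; x + ξe_μ, x′) − G′(□; x, x′))|·e^{δ′|x − x′|_∞/L^j} ≤ c′` (`ξ = L^{−j}`,
`ξ^{−1}(φ(x + ξe_μ) − φ(x)) = (∂^{ξ}_μφ)(x)`).  Inputs BY NAME: `B4Thm110ZeroBoxDeriv.thm110_zero_box_deriv_roww_coeff`
([3] Theorem (1.10), derivative clause, at `A = 0` for boxes), `B4Thm110ZeroBox.thm110_zero_box_roww_coeff`,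
`B4BoxCov237.cov116_box_finset_decay`.  HONEST SCOPE as in `ineq243_twoLevel_roww`.
[cite: Balaban1984PropagatorsII, (2.43) p.230] -/
theorem ineq243_twoLevel_deriv_wsum (d ℓ : ℕ) (hℓ : 1 ≤ ℓ) (aminus aplus m2plus a2minus a2plus : ℝ)
    (ha : 0 < aminus) (ha2 : 0 < a2minus) :
    ∃ δ' c' : ℝ, 0 < δ' ∧ 0 < c' ∧ ∀ (k : ℕ), 1 ≤ k → ∀ (aj m2 a : ℝ), aminus ≤ aj → aj ≤ aplus → 0 ≤ m2 →
      m2 ≤ m2plus → a2minus ≤ a → a ≤ a2plus → ∀ (M' : Fin (d + 1) → ℕ), (∀ i, 1 ≤ M' i) →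
        ∀ (Λ : Finset ↥(boxDom (fun i => (ℓ + 1) * M' i))) (μ : Fin (d + 1))
          (x xe : ↥(boxDom (fun i => (ℓ + 1) ^ k * ((ℓ + 1) * M' i)))), xe.1 = x.1 + Pi.single μ 1 →
          ∑ x', |(((ℓ + 1) ^ k : ℕ) : ℝ) * (gTwoLevel ((ℓ + 1) ^ k) ℓ aj a m2 M' Λ xe x'
                - gTwoLevel ((ℓ + 1) ^ k) ℓ aj a m2 M' Λ x x')|
              * Real.exp (δ' * supNorm (x.1 - x'.1) / (((ℓ + 1) ^ k : ℕ) : ℝ)) ≤ c' := by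
  obtain ⟨δ₀, c₀, hδ₀, hc₀, hG⟩ := thm110_zero_box_roww_coeff d ℓ hℓ aminus aplus m2plus ha
  obtain ⟨δ₁, c₁, hδ₁, hc₁, hGD⟩ := thm110_zero_box_deriv_roww_coeff d ℓ hℓ aminus aplus m2plus ha
  obtain ⟨δ, c, hδ, hc, hC⟩ := cov116_box_finset_decay d ℓ hℓ aminus aplus m2plus a2minus a2plus ha ha2
  have hδ'pos : 0 < min (min δ₀ δ₁) (δ / 2) := lt_min (lt_min hδ₀ hδ₁) (half_pos hδ)
  have hKn : 0 ≤ latticeConst (d + 1) (δ / 2) := latticeConst_nonneg (d + 1) (half_pos hδ).le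
  refine ⟨min (min δ₀ δ₁) (δ / 2),
    c₁ + aplus ^ 2 * (c₁ * (c * Real.exp (min (min δ₀ δ₁) (δ / 2)) * latticeConst (d + 1) (δ / 2)) * c₀),
    hδ'pos, by positivity, ?_⟩
  intro k hk aj m2 a h1 h2 h3 h4 h5 h6 M' hM Λ μ x xe hxe
  have hn1 : 1 ≤ (ℓ + 1) ^ k := Nat.one_le_pow _ _ (by omega)
  have hMℓ : ∀ i, 1 ≤ (ℓ + 1) * M' i := fun i => by nlinarith [hM i]
  have haj : 0 < aj := lt_of_lt_of_le ha h1
  have hGz : ∀ z, roww δ₀ ((ℓ + 1) ^ k) (boxOpR ((ℓ + 1) ^ k) aj m2 (fun i => (ℓ + 1) * M' i))⁻¹ z ≤ c₀ :=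
    fun z => hG k hk aj m2 h1 h2 h3 h4 (fun i => (ℓ + 1) * M' i) hMℓ z
  have hGDx : wsum δ₁ ((ℓ + 1) ^ k) x (fun x' => ((((ℓ + 1) ^ k : ℕ)) : ℝ)
      * ((boxOpR ((ℓ + 1) ^ k) aj m2 (fun i => (ℓ + 1) * M' i))⁻¹ xe x'
        - (boxOpR ((ℓ + 1) ^ k) aj m2 (fun i => (ℓ + 1) * M' i))⁻¹ x x')) ≤ c₁ :=
    hGD k hk aj m2 h1 h2 h3 h4 (fun i => (ℓ + 1) * M' i) hMℓ μ x xe hxe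
  have hCz := (hC ((ℓ + 1) ^ k) hn1 aj m2 a h1 h2 h3 h4 h5 h6 M' hM Λ).2
  have hmain := gTwoLevel_deriv_wsum_le hn1 aj a m2 Λ hc₀.le hc.le hδ hδ'pos.le
    ((min_le_left _ _).trans (min_le_left _ _)) ((min_le_left _ _).trans (min_le_right _ _))
    (min_le_right _ _) hGz hCz x xe hGDx
  rw [wsum] at hmain
  refine hmain.trans ?_
  have : aj ^ 2 ≤ aplus ^ 2 := pow_le_pow_left₀ haj.le h2 2
  have h0 : 0 ≤ c₁ * (c * Real.exp (min (min δ₀ δ₁) (δ / 2)) * latticeConst (d + 1) (δ / 2)) * c₀ := by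
    positivity
  nlinarith

/-- **[B6] (2.43), SECOND QUANTITY — THE PRINTED VALUE CLAUSE** `|(∂^{L^{−j}}_μG′(□)λ)(x)| ≤ O(1)e^{−δ₀dist(x, supp λ)}|λ|`
for the genuine two-level cube propagator, uniformly in the mesh: for every `λ`, every `F ≥ |λ|`, every pair of
neighbours `x, xe = x + ξe_μ` and every `D ≤ |x − x′|_∞` on `supp λ`:
`|ξ^{−1}((G′(□)λ)(x + ξe_μ) − (G′(□)λ)(x))| ≤ c′e^{−δ′D/L^j}F`. [cite: Balaban1984PropagatorsII, (2.43) p.230] -/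
theorem ineq243_twoLevel_deriv_value (d ℓ : ℕ) (hℓ : 1 ≤ ℓ) (aminus aplus m2plus a2minus a2plus : ℝ)
    (ha : 0 < aminus) (ha2 : 0 < a2minus) :
    ∃ δ' c' : ℝ, 0 < δ' ∧ 0 < c' ∧ ∀ (k : ℕ), 1 ≤ k → ∀ (aj m2 a : ℝ), aminus ≤ aj → aj ≤ aplus → 0 ≤ m2 →
      m2 ≤ m2plus → a2minus ≤ a → a ≤ a2plus → ∀ (M' : Fin (d + 1) → ℕ), (∀ i, 1 ≤ M' i) →
        ∀ (Λ : Finset ↥(boxDom (fun i => (ℓ + 1) * M' i)))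
          (f : ↥(boxDom (fun i => (ℓ + 1) ^ k * ((ℓ + 1) * M' i))) → ℝ) (F D : ℝ), (∀ x', |f x'| ≤ F) →
          ∀ (μ : Fin (d + 1)) (x xe : ↥(boxDom (fun i => (ℓ + 1) ^ k * ((ℓ + 1) * M' i)))),
            xe.1 = x.1 + Pi.single μ 1 → (∀ x', f x' ≠ 0 → D ≤ supNorm (x.1 - x'.1)) →
              |(((ℓ + 1) ^ k : ℕ) : ℝ) * ((gTwoLevel ((ℓ + 1) ^ k) ℓ aj a m2 M' Λ *ᵥ f) xe
                  - (gTwoLevel ((ℓ + 1) ^ k) ℓ aj a m2 M' Λ *ᵥ f) x)|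
                ≤ c' * Real.exp (-(δ' * D / (((ℓ + 1) ^ k : ℕ) : ℝ))) * F := by
  obtain ⟨δ', c', hδ', hc', h⟩ := ineq243_twoLevel_deriv_wsum d ℓ hℓ aminus aplus m2plus a2minus a2plus ha ha2
  refine ⟨δ', c', hδ', hc', ?_⟩
  intro k hk aj m2 a h1 h2 h3 h4 h5 h6 M' hM Λ f F D hF μ x xe hxe hD
  rw [mulVec_sub_mulVec]
  exact abs_sum_mul_le_of_wsum hδ'.le _ x _ (h k hk aj m2 a h1 h2 h3 h4 h5 h6 M' hM Λ μ x xe hxe) f hF hD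

/-! ## §8 (2.44): the commutator `K(h_□) = h_□Δ′_a − Δ′_ah_□` of (2.38)–(2.40) against `G′(□)h_□`, at mesh `L^{−j}` -/

section Commutator

variable {N : Fin (d + 1) → ℕ}

/-- **THE COMMUTATOR `K(h) = hD − Dh` OF (2.38)** (multiplication by the cut-off `h` against the box operator `D`),
as a matrix: `K(h)(x, x″) = (h(x) − h(x″))·D(x, x″)` — every entry carries a DIFFERENCE of `h` (the mechanism of (2.40):
«the functions h_□ … rescale[d] to proper scales»). [cite: Balaban1984PropagatorsII, (2.38)–(2.39) p.229] -/
def kComm (D : Matrix ↥(boxDom N) ↥(boxDom N) ℝ) (h : ↥(boxDom N) → ℝ) : Matrix ↥(boxDom N) ↥(boxDom N) ℝ :=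
  Matrix.diagonal h * D - D * Matrix.diagonal h

/-- entries of the commutator. [cite: Balaban1984PropagatorsII, (2.38)–(2.39) p.229] -/
theorem kComm_apply (D : Matrix ↥(boxDom N) ↥(boxDom N) ℝ) (h : ↥(boxDom N) → ℝ) (x x'' : ↥(boxDom N)) :
    kComm D h x x'' = (h x - h x'') * D x x'' := by
  simp only [kComm, Matrix.sub_apply, Matrix.diagonal_mul, Matrix.mul_diagonal]
  ring

/-- `(K(h)u)(x) = Σ_{x″} D(x, x″)(h(x) − h(x″))u(x″)`. [cite: Balaban1984PropagatorsII, (2.39)–(2.40) pp.229–230] -/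
theorem kComm_mulVec (D : Matrix ↥(boxDom N) ↥(boxDom N) ℝ) (h u : ↥(boxDom N) → ℝ) (x : ↥(boxDom N)) :
    (kComm D h *ᵥ u) x = ∑ x'', D x x'' * (h x - h x'') * u x'' := by
  simp only [Matrix.mulVec, dotProduct, kComm_apply]
  exact Finset.sum_congr rfl fun _ _ => by ring

/-- **(2.38) ON THE BOX**: if `D·G′(□) = 1` then `D·(h G′(□) h) = h² − K(h)G′(□)h` — one term of
«Δ′_aG′₀ = I − Σ_□ K(h_□)G′(□)h_□» (the torus operator `Δ′_a` agrees with the box operator on cut-offs vanishing at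
`∂□`; that bookkeeping is `B6Eq250`/`B6SectA.generator238`). [cite: Balaban1984PropagatorsII, (2.37)–(2.38) p.229] -/
theorem eq238_box (D G : Matrix ↥(boxDom N) ↥(boxDom N) ℝ) (h : ↥(boxDom N) → ℝ) (hDG : D * G = 1) :
    D * (Matrix.diagonal h * G * Matrix.diagonal h)
      = Matrix.diagonal (fun x => h x * h x) - kComm D h * G * Matrix.diagonal h := by
  have e : D * (Matrix.diagonal h * G * Matrix.diagonal h)
      = Matrix.diagonal h * (D * G) * Matrix.diagonal h
        - (Matrix.diagonal h * D - D * Matrix.diagonal h) * G * Matrix.diagonal h := by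
    noncomm_ring
  rw [e, hDG, Matrix.mul_one, Matrix.diagonal_mul_diagonal]
  rfl

/-- the Laplacian part of `Σ_{x″} D(x,x″)(h(x) − h(x″))u(x″)` is the first two terms of (2.40):
`Σ_{b∈st(x)}(∂h)(b)(∂u)(b) + u(x)·n²Σ_{x″∼x}(h(x″) − h(x))` (summation by parts at the point `x`).
[cite: Balaban1984PropagatorsII, (2.40) p.230] -/
theorem lap_comm_sum_eq (n : ℕ) (h u : ↥(boxDom N) → ℝ) (x : ↥(boxDom N)) :
    ∑ x'', (n : ℝ) ^ 2 * (neumannLapK N x.1 x''.1 : ℝ) * (h x - h x'') * u x''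
      = ∑ x'' ∈ boxNbrs N x, ((n : ℝ) * (h x'' - h x)) * ((n : ℝ) * (u x'' - u x))
        + u x * ((n : ℝ) ^ 2 * ∑ x'' ∈ boxNbrs N x, (h x'' - h x)) := by
  classical
  have hpt : ∀ x'' : ↥(boxDom N), (n : ℝ) ^ 2 * (neumannLapK N x.1 x''.1 : ℝ) * (h x - h x'') * u x''
      = if x'' ∈ boxNbrs N x then -((n : ℝ) ^ 2 * (h x - h x'') * u x'') else 0 := by
    intro x''
    by_cases hxx : x'' = x
    · subst hxx
      simp [not_mem_boxNbrs_self]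
    · have hxx' : x''.1 ≠ x.1 := fun e => hxx (Subtype.ext e)
      by_cases hn : x''.1 ∈ nbrs x.1
      · have hmem : x'' ∈ boxNbrs N x := by
          unfold boxNbrs; simp only [Finset.mem_filter, Finset.mem_univ, true_and]; exact hn
        simp [neumannLapK, hxx', hn, hmem]
      · have hmem : x'' ∉ boxNbrs N x := by
          unfold boxNbrs; simp only [Finset.mem_filter, Finset.mem_univ, true_and]; exact hn
        simp [neumannLapK, hxx', hn, hmem]
  rw [Finset.sum_congr rfl fun x'' _ => hpt x'', ← Finset.sum_filter, Finset.filter_mem_eq_inter,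
    Finset.univ_inter, Finset.mul_sum, Finset.mul_sum, ← Finset.sum_add_distrib]
  exact Finset.sum_congr rfl fun x'' _ => by ring

/-- the mass term commutes with multiplication operators. [cite: Balaban1984PropagatorsII, (2.40) p.230] -/
theorem diag_comm_sum_eq_zero (m2 : ℝ) (h u : ↥(boxDom N) → ℝ) (x : ↥(boxDom N)) :
    ∑ x'', (diagK m2 x.1 x''.1 : ℝ) * (h x - h x'') * u x'' = 0 := by
  refine Finset.sum_eq_zero fun x'' _ => ?_
  by_cases hxx : x''.1 = x.1
  · have : x'' = x := Subtype.ext hxx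
    rw [this, sub_self, mul_zero, zero_mul]
  · simp [diagK, hxx]

/-- in-box neighbours are at most `2(d + 1)`. [cite: Balaban1983RegularityDecay, p. 572 («e_μ is a unit vector of μ^th
axis»), dictionary] -/
theorem card_boxNbrs_le (x : ↥(boxDom N)) : (boxNbrs N x).card ≤ 2 * (d + 1) := by
  rw [card_boxNbrs, ← card_nbrs x.1]
  exact Finset.card_filter_le _ _

/-- neighbours are at sup-distance `≤ 1`. [cite: Balaban1983RegularityDecay, p. 572, dictionary] -/
theorem supNorm_sub_le_one_of_mem_boxNbrs {x x'' : ↥(boxDom N)} (hx : x'' ∈ boxNbrs N x) :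
    supNorm (x''.1 - x.1) ≤ 1 := by
  unfold boxNbrs at hx
  simp only [Finset.mem_filter, Finset.mem_univ, true_and] at hx
  obtain ⟨μ, e | e⟩ := mem_nbrs.1 hx
  · rw [e, add_sub_cancel_left]
    exact B4Thm110ZeroBoxDeriv.supNorm_single_le μ
  · rw [e, show x.1 - Pi.single μ 1 - x.1 = -(Pi.single μ (1 : ℤ) : Fin (d + 1) → ℤ) by abel,
      B4TorusKernel.supNorm_neg]
    exact B4Thm110ZeroBoxDeriv.supNorm_single_le μ

end Commutator

/-- summing a function of the block label over the fine box: `Σ_{x ∈ X} f(blk x) = n^{d+1}Σ_{y ∈ □^{(j)}} f(y)`.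
[cite: Balaban1983RegularityDecay, p. 572 (1.1) (blocks of `n^{d+1}` sites), dictionary] -/
theorem sum_comp_ublk {n : ℕ} (hn : 1 ≤ n) (M : Fin (d + 1) → ℕ) (f : ↥(boxDom M) → ℝ) :
    ∑ x : ↥(boxDom (fun i => n * M i)), f (ublk hn x) = ((n : ℝ)) ^ (d + 1) * ∑ y, f y := by
  have hmaps : ∀ z ∈ (Finset.univ : Finset ↥(boxDom (fun i => n * M i))),
      ublk hn z ∈ (Finset.univ : Finset ↥(boxDom M)) := fun _ _ => Finset.mem_univ _
  rw [← Finset.sum_fiberwise_of_maps_to hmaps, Finset.mul_sum]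
  refine Finset.sum_congr rfl fun y _ => ?_
  rw [Finset.sum_congr rfl (g := fun _ => f y) fun z hz => by rw [(Finset.mem_filter.1 hz).2],
    Finset.sum_const, nsmul_eq_mul]
  congr 1
  rw [← Nat.cast_pow, ← card_filter_blk hn M y, Nat.cast_inj]
  exact congrArg Finset.card (Finset.filter_congr fun z _ => Subtype.ext_iff)

/-- the AVERAGING ENTRIES of the two-level operator's row at `x` (the third term of (2.40)): `a_{j+1}L^{−2}(nL)^{−(d+1)}
[x″ ∼_{j+1} x]` if the `j`-block of `x` lies in `Λ`, `a_jn^{−(d+1)}[x″ ∼_j x]` otherwise.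
[cite: Balaban1984PropagatorsII, (2.40) p.230 with (2.14) p.225] -/
def vEntry {n : ℕ} (hn : 1 ≤ n) (ℓ : ℕ) (aj a : ℝ) {M' : Fin (d + 1) → ℕ}
    (Λ : Finset ↥(boxDom (fun i => (ℓ + 1) * M' i))) (x x'' : ↥(boxDom (fun i => n * ((ℓ + 1) * M' i)))) : ℝ :=
  if ublk hn x ∈ Λ then
    (if blk (n * (ℓ + 1)) x''.1 = blk (n * (ℓ + 1)) x.1 then
      aNext ℓ aj a / (((ℓ : ℝ) + 1)) ^ 2 * ((((n : ℝ) * ((ℓ : ℝ) + 1)) ^ (d + 1))⁻¹) else 0)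
  else avgK (aj * ((n : ℝ) ^ (d + 1))⁻¹) n x.1 x''.1

/-- the entries of the two-level operator, averaging part named. [cite: Balaban1984PropagatorsII, (2.40)–(2.41) p.230] -/
theorem twoLevelOp_apply' {n ℓ : ℕ} (hn : 1 ≤ n) (aj a m2 : ℝ) {M' : Fin (d + 1) → ℕ}
    {Λ : Finset ↥(boxDom (fun i => (ℓ + 1) * M' i))} (hΛ : IsBlockUnion ℓ M' Λ)
    (x x' : ↥(boxDom (fun i => n * ((ℓ + 1) * M' i)))) :
    twoLevelOp n ℓ aj a m2 M' Λ x x'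
      = (n : ℝ) ^ 2 * neumannLapK (fun i => n * ((ℓ + 1) * M' i)) x.1 x'.1 + diagK m2 x.1 x'.1
        + vEntry hn ℓ aj a Λ x x' :=
  twoLevelOp_apply hn aj a m2 hΛ x x'

/-- the averaging entries are nonnegative (`a_j > 0`, `a ≥ 0`). [cite: Balaban1984PropagatorsII, (2.14) p.225] -/
theorem vEntry_nonneg {n : ℕ} (hn : 1 ≤ n) (ℓ : ℕ) {aj a : ℝ} (haj : 0 < aj) (ha : 0 ≤ a)
    {M' : Fin (d + 1) → ℕ} (Λ : Finset ↥(boxDom (fun i => (ℓ + 1) * M' i)))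
    (x x'' : ↥(boxDom (fun i => n * ((ℓ + 1) * M' i)))) : 0 ≤ vEntry hn ℓ aj a Λ x x'' := by
  have : 0 ≤ aNext ℓ aj a := by unfold aNext; positivity
  unfold vEntry avgK
  split_ifs <;> positivity

/-- a nonzero averaging entry joins two sites of a common `(j+1)`-block: `|x − x″|_∞ ≤ nL`.
[cite: Balaban1984PropagatorsII, (2.40) p.230, bookkeeping] -/
theorem supNorm_le_of_vEntry_ne_zero {n : ℕ} (hn : 1 ≤ n) (ℓ : ℕ) (aj a : ℝ) {M' : Fin (d + 1) → ℕ}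
    (Λ : Finset ↥(boxDom (fun i => (ℓ + 1) * M' i))) {x x'' : ↥(boxDom (fun i => n * ((ℓ + 1) * M' i)))}
    (h : vEntry hn ℓ aj a Λ x x'' ≠ 0) : supNorm (x.1 - x''.1) ≤ (n : ℝ) * ((ℓ : ℝ) + 1) := by
  have hnL : 1 ≤ n * (ℓ + 1) := le_trans hn (Nat.le_mul_of_pos_right n (by omega))
  have hL1 : (1 : ℝ) ≤ (ℓ : ℝ) + 1 := by linarith [(Nat.cast_nonneg ℓ : (0 : ℝ) ≤ ℓ)]
  have hn0 : (0 : ℝ) ≤ n := Nat.cast_nonneg n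
  unfold vEntry at h
  by_cases hx : ublk hn x ∈ Λ
  · rw [if_pos hx] at h
    by_cases e : blk (n * (ℓ + 1)) x''.1 = blk (n * (ℓ + 1)) x.1
    · have := supNorm_sub_le_of_blk_eq hnL e.symm
      push_cast at this
      linarith
    · rw [if_neg e] at h
      exact absurd rfl h
  · rw [if_neg hx] at h
    unfold avgK at h
    by_cases e : blk n x''.1 = blk n x.1
    · have := supNorm_sub_le_of_blk_eq hn e.symm
      nlinarith
    · rw [if_neg e] at h
      exact absurd rfl h

/-- the total weight of a row of the averaging part: `a_j` off `Λ` (the `n^{d+1}` sites of a `j`-block, weight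
`a_jn^{−(d+1)}`), `a_{j+1}L^{−2}` on `Λ` (the `(nL)^{d+1}` sites of a `(j+1)`-block); in both cases `≤ a_j + a`
(`a_{j+1} ≤ a`). [cite: Balaban1984PropagatorsII, (2.14) p.225, (2.40) p.230] -/
theorem sum_vEntry_le {n ℓ : ℕ} (hn : 1 ≤ n) {aj a : ℝ} (haj : 0 < aj) (ha : 0 ≤ a) {M' : Fin (d + 1) → ℕ}
    (Λ : Finset ↥(boxDom (fun i => (ℓ + 1) * M' i))) (x : ↥(boxDom (fun i => n * ((ℓ + 1) * M' i)))) :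
    ∑ x'' : ↥(boxDom (fun i => n * ((ℓ + 1) * M' i))), vEntry hn ℓ aj a Λ x x'' ≤ aj + a := by
  have hL1 : 1 ≤ ℓ + 1 := by omega
  have hn' : (0 : ℝ) < n := by exact_mod_cast hn
  have hL' : (0 : ℝ) < (ℓ : ℝ) + 1 := by positivity
  have hbb : ∀ z : ↥(boxDom (fun i => n * ((ℓ + 1) * M' i))),
      blk (n * (ℓ + 1)) z.1 = blk (ℓ + 1) (ublk hn z).1 := fun z => (blk_blk (ℓ + 1) n z.1).symm
  have hnext_le : aNext ℓ aj a ≤ a := by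
    unfold aNext
    rw [div_le_iff₀ (by positivity)]
    nlinarith [mul_nonneg ha (show (0 : ℝ) ≤ a * ((((ℓ : ℝ) + 1)) ^ 2)⁻¹ by positivity)]
  have hnext_nn : 0 ≤ aNext ℓ aj a := by unfold aNext; positivity
  unfold vEntry
  by_cases hx : ublk hn x ∈ Λ
  · simp_rw [if_pos hx, hbb]
    rw [sum_comp_ublk hn (fun i => (ℓ + 1) * M' i)
      (fun y => if blk (ℓ + 1) y.1 = blk (ℓ + 1) (ublk hn x).1 then
        aNext ℓ aj a / (((ℓ : ℝ) + 1)) ^ 2 * ((((n : ℝ) * ((ℓ : ℝ) + 1)) ^ (d + 1))⁻¹) else 0),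
      ← Finset.sum_filter, Finset.sum_const, nsmul_eq_mul]
    have hcard : (Finset.univ.filter (fun y : ↥(boxDom (fun i => (ℓ + 1) * M' i)) =>
        blk (ℓ + 1) y.1 = blk (ℓ + 1) (ublk hn x).1)).card = (ℓ + 1) ^ (d + 1) :=
      card_filter_blk hL1 M' ⟨blk (ℓ + 1) (ublk hn x).1, blk_mem_boxDom hL1 (ublk hn x).2⟩
    rw [hcard]
    push_cast
    rw [mul_pow, mul_inv, show ((n : ℝ)) ^ (d + 1) * ((((ℓ : ℝ) + 1)) ^ (d + 1)
        * (aNext ℓ aj a / (((ℓ : ℝ) + 1)) ^ 2 * ((((n : ℝ)) ^ (d + 1))⁻¹ * ((((ℓ : ℝ) + 1)) ^ (d + 1))⁻¹)))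
        = aNext ℓ aj a / (((ℓ : ℝ) + 1)) ^ 2 by field_simp]
    calc aNext ℓ aj a / (((ℓ : ℝ) + 1)) ^ 2 ≤ aNext ℓ aj a / 1 := by
          apply div_le_div_of_nonneg_left hnext_nn one_pos
          nlinarith
      _ ≤ aj + a := by rw [div_one]; linarith
  · simp_rw [if_neg hx]
    have hpt : ∀ x'' : ↥(boxDom (fun i => n * ((ℓ + 1) * M' i))), avgK (aj * (((n : ℝ)) ^ (d + 1))⁻¹) n x.1 x''.1
        = (fun y : ↥(boxDom (fun i => (ℓ + 1) * M' i)) =>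
            if y = ublk hn x then aj * (((n : ℝ)) ^ (d + 1))⁻¹ else 0) (ublk hn x'') := by
      intro x''
      simp only [avgK]
      by_cases e : blk n x''.1 = blk n x.1
      · rw [if_pos e, if_pos (Subtype.ext e)]
      · rw [if_neg e, if_neg (fun hh => e (congrArg Subtype.val hh))]
    rw [Finset.sum_congr rfl fun x'' _ => hpt x'', sum_comp_ublk hn (fun i => (ℓ + 1) * M' i)
      (fun y => if y = ublk hn x then aj * (((n : ℝ)) ^ (d + 1))⁻¹ else 0),
      Finset.sum_ite_eq' Finset.univ (ublk hn x), if_pos (Finset.mem_univ _)]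
    rw [show ((n : ℝ)) ^ (d + 1) * (aj * (((n : ℝ)) ^ (d + 1))⁻¹) = aj by field_simp]
    linarith

/-- **THE DETERMINISTIC (2.44)**: for the genuine two-level operator `D` (`Λ` a union of `L`-blocks) and its
propagator `G′(□)` with weighted row bound `c′` and weighted differenced-row bound `c∂` at a common rate `δ′ ≥ 0`, a
cut-off `h` with unit-scale Lipschitz constant `κ₁` (`|h(x″) − h(x)| ≤ κ₁|x″ − x|_∞/n`) and unit-scale Laplacian
`|n²Σ_{x″∼x}(h(x″) − h(x))| ≤ κ₂`, every `g` with `|g| ≤ F` and every `D ≤ dist_∞(x, supp g)`: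
`|(K(h)G′(□)g)(x)| ≤ (2(d+1)c∂e^{δ′}κ₁ + c′κ₂ + (a_j + a)Le^{δ′L}c′κ₁)·e^{−δ′D/n}·F` — the three terms of (2.40)
bounded by (2.43)₂, (2.43)₁ and (2.43)₁ on the `(j+1)`-block. [cite: Balaban1984PropagatorsII, (2.40), (2.43)–(2.44) p.230] -/
theorem kComm_gTwoLevel_pointwise {n ℓ : ℕ} (hn : 1 ≤ n) {aj a m2 : ℝ} (haj : 0 < aj) (ha : 0 ≤ a)
    {M' : Fin (d + 1) → ℕ} {Λ : Finset ↥(boxDom (fun i => (ℓ + 1) * M' i))} (hΛ : IsBlockUnion ℓ M' Λ)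
    {δ' c' cD κ₁ κ₂ : ℝ} (hδ' : 0 ≤ δ') (hc' : 0 ≤ c') (hcD : 0 ≤ cD) (hκ₁ : 0 ≤ κ₁)
    (hrow : ∀ z, roww δ' n (gTwoLevel n ℓ aj a m2 M' Λ) z ≤ c')
    (hdrow : ∀ (μ : Fin (d + 1)) (z ze : ↥(boxDom (fun i => n * ((ℓ + 1) * M' i)))),
      ze.1 = z.1 + Pi.single μ 1 →
        wsum δ' n z (fun x' => (n : ℝ) * (gTwoLevel n ℓ aj a m2 M' Λ ze x' - gTwoLevel n ℓ aj a m2 M' Λ z x'))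
          ≤ cD)
    (h : ↥(boxDom (fun i => n * ((ℓ + 1) * M' i))) → ℝ)
    (hLip : ∀ z z' : ↥(boxDom (fun i => n * ((ℓ + 1) * M' i))), |h z' - h z| ≤ κ₁ * supNorm (z'.1 - z.1) / n)
    (hLap : ∀ z : ↥(boxDom (fun i => n * ((ℓ + 1) * M' i))),
      |(n : ℝ) ^ 2 * ∑ z' ∈ boxNbrs _ z, (h z' - h z)| ≤ κ₂)
    (g : ↥(boxDom (fun i => n * ((ℓ + 1) * M' i))) → ℝ) {F Dd : ℝ} (hF : ∀ x', |g x'| ≤ F)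
    (x : ↥(boxDom (fun i => n * ((ℓ + 1) * M' i)))) (hD : ∀ x', g x' ≠ 0 → Dd ≤ supNorm (x.1 - x'.1)) :
    |(kComm (twoLevelOp n ℓ aj a m2 M' Λ) h *ᵥ (gTwoLevel n ℓ aj a m2 M' Λ *ᵥ g)) x|
      ≤ (2 * (d + 1) * cD * Real.exp δ' * κ₁ + c' * κ₂
          + (aj + a) * ((ℓ : ℝ) + 1) * Real.exp (δ' * ((ℓ : ℝ) + 1)) * c' * κ₁)
        * Real.exp (-(δ' * Dd / n)) * F := by
  have hn' : (0 : ℝ) < n := by exact_mod_cast hn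
  have hn1 : (1 : ℝ) ≤ n := by exact_mod_cast hn
  have hF0 : 0 ≤ F := (abs_nonneg _).trans (hF x)
  set G := gTwoLevel n ℓ aj a m2 M' Λ with hGdef
  set E := Real.exp (-(δ' * Dd / n)) with hE
  have hE0 : 0 < E := Real.exp_pos _
  -- (2.43)₁ at a point z at sup-distance ≤ r from x
  have hval : ∀ (z : ↥(boxDom (fun i => n * ((ℓ + 1) * M' i)))) (r : ℝ), supNorm (x.1 - z.1) ≤ r →
      |(G *ᵥ g) z| ≤ c' * Real.exp (δ' * r / n) * E * F := by
    intro z r hr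
    have hDz : ∀ x', g x' ≠ 0 → Dd - r ≤ supNorm (z.1 - x'.1) := by
      intro x' hx'
      have := supNorm_sub_le_sub_add_sub x.1 z.1 x'.1
      linarith [hD x' hx']
    calc |(G *ᵥ g) z| ≤ c' * Real.exp (-(δ' * (Dd - r) / n)) * F := mulVec_le_of_roww hδ' n G z (hrow z) g hF hDz
      _ = c' * Real.exp (δ' * r / n) * E * F := by
          rw [hE, show -(δ' * (Dd - r) / (n : ℝ)) = δ' * r / n + -(δ' * Dd / n) by ring, Real.exp_add]
          ring
  -- (2.43)₂ across an in-box bond at x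
  have hder : ∀ x'' ∈ boxNbrs _ x, |(n : ℝ) * ((G *ᵥ g) x'' - (G *ᵥ g) x)| ≤ cD * Real.exp δ' * E * F := by
    intro x'' hx''
    have hmem := hx''
    unfold boxNbrs at hmem
    simp only [Finset.mem_filter, Finset.mem_univ, true_and] at hmem
    have he1 : Real.exp (-(δ' * Dd / n)) ≤ Real.exp δ' * E := by
      rw [hE]
      have : (1 : ℝ) ≤ Real.exp δ' := Real.one_le_exp hδ'
      nlinarith [Real.exp_pos (-(δ' * Dd / (n : ℝ)))]
    have he2 : Real.exp (-(δ' * (Dd - 1) / n)) ≤ Real.exp δ' * E := by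
      rw [hE, show -(δ' * (Dd - 1) / (n : ℝ)) = δ' / n + -(δ' * Dd / n) by ring, Real.exp_add]
      exact mul_le_mul_of_nonneg_right (Real.exp_le_exp.2 (div_le_self hδ' hn1)) (Real.exp_pos _).le
    obtain ⟨μ, e | e⟩ := mem_nbrs.1 hmem
    · have hb := abs_sum_mul_le_of_wsum hδ' n x _ (hdrow μ x x'' e) g hF hD
      rw [← mulVec_sub_mulVec] at hb
      calc |(n : ℝ) * ((G *ᵥ g) x'' - (G *ᵥ g) x)| ≤ cD * Real.exp (-(δ' * Dd / n)) * F := hb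
        _ ≤ cD * (Real.exp δ' * E) * F :=
            mul_le_mul_of_nonneg_right (mul_le_mul_of_nonneg_left he1 hcD) hF0
        _ = cD * Real.exp δ' * E * F := by ring
    · have e' : x.1 = x''.1 + Pi.single μ 1 := by rw [e]; abel
      have hDz : ∀ x', g x' ≠ 0 → Dd - 1 ≤ supNorm (x''.1 - x'.1) := by
        intro x' hx'
        have h1 := supNorm_sub_le_sub_add_sub x.1 x''.1 x'.1
        have h2 : supNorm (x.1 - x''.1) ≤ 1 := by
          rw [e', add_sub_cancel_left]; exact B4Thm110ZeroBoxDeriv.supNorm_single_le μ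
        linarith [hD x' hx']
      have hb := abs_sum_mul_le_of_wsum hδ' n x'' _ (hdrow μ x'' x e') g hF hDz
      rw [← mulVec_sub_mulVec] at hb
      calc |(n : ℝ) * ((G *ᵥ g) x'' - (G *ᵥ g) x)| = |(n : ℝ) * ((G *ᵥ g) x - (G *ᵥ g) x'')| := by
            rw [show (n : ℝ) * ((G *ᵥ g) x'' - (G *ᵥ g) x) = -((n : ℝ) * ((G *ᵥ g) x - (G *ᵥ g) x'')) by ring,
              abs_neg]
        _ ≤ cD * Real.exp (-(δ' * (Dd - 1) / n)) * F := hb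
        _ ≤ cD * (Real.exp δ' * E) * F :=
            mul_le_mul_of_nonneg_right (mul_le_mul_of_nonneg_left he2 hcD) hF0
        _ = cD * Real.exp δ' * E * F := by ring
  -- the entries of D and the three sums
  rw [kComm_mulVec]
  simp_rw [twoLevelOp_apply' hn aj a m2 hΛ x]
  have hsplit : ∀ x'' : ↥(boxDom (fun i => n * ((ℓ + 1) * M' i))),
      ((n : ℝ) ^ 2 * neumannLapK (fun i => n * ((ℓ + 1) * M' i)) x.1 x''.1 + diagK m2 x.1 x''.1
        + vEntry hn ℓ aj a Λ x x'') * (h x - h x'') * (G *ᵥ g) x''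
      = (n : ℝ) ^ 2 * (neumannLapK (fun i => n * ((ℓ + 1) * M' i)) x.1 x''.1 : ℝ) * (h x - h x'') * (G *ᵥ g) x''
        + (diagK m2 x.1 x''.1 : ℝ) * (h x - h x'') * (G *ᵥ g) x''
        + vEntry hn ℓ aj a Λ x x'' * (h x - h x'') * (G *ᵥ g) x'' := fun x'' => by ring
  simp_rw [hsplit]
  rw [Finset.sum_add_distrib, Finset.sum_add_distrib, lap_comm_sum_eq, diag_comm_sum_eq_zero, add_zero]
  -- bound the three pieces
  have hA : |∑ x'' ∈ boxNbrs _ x, ((n : ℝ) * (h x'' - h x)) * ((n : ℝ) * ((G *ᵥ g) x'' - (G *ᵥ g) x))|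
      ≤ 2 * (d + 1) * cD * Real.exp δ' * κ₁ * E * F := by
    calc |∑ x'' ∈ boxNbrs _ x, ((n : ℝ) * (h x'' - h x)) * ((n : ℝ) * ((G *ᵥ g) x'' - (G *ᵥ g) x))|
        ≤ ∑ x'' ∈ boxNbrs _ x, |((n : ℝ) * (h x'' - h x)) * ((n : ℝ) * ((G *ᵥ g) x'' - (G *ᵥ g) x))| :=
          Finset.abs_sum_le_sum_abs _ _
      _ ≤ ∑ x'' ∈ boxNbrs _ x, κ₁ * (cD * Real.exp δ' * E * F) := by
          refine Finset.sum_le_sum fun x'' hx'' => ?_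
          rw [abs_mul]
          refine mul_le_mul ?_ (hder x'' hx'') (abs_nonneg _) hκ₁
          rw [abs_mul, abs_of_nonneg hn'.le]
          have h1 := hLip x x''
          have h2 := supNorm_sub_le_one_of_mem_boxNbrs hx''
          calc (n : ℝ) * |h x'' - h x| ≤ (n : ℝ) * (κ₁ * supNorm (x''.1 - x.1) / n) :=
                mul_le_mul_of_nonneg_left h1 hn'.le
            _ = κ₁ * supNorm (x''.1 - x.1) := by field_simp
            _ ≤ κ₁ * 1 := mul_le_mul_of_nonneg_left h2 hκ₁
            _ = κ₁ := mul_one _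
      _ = (boxNbrs _ x).card * (κ₁ * (cD * Real.exp δ' * E * F)) := by
          rw [Finset.sum_const, nsmul_eq_mul]
      _ ≤ (2 * (d + 1) : ℝ) * (κ₁ * (cD * Real.exp δ' * E * F)) := by
          refine mul_le_mul_of_nonneg_right ?_ (by positivity)
          exact_mod_cast card_boxNbrs_le x
      _ = 2 * (d + 1) * cD * Real.exp δ' * κ₁ * E * F := by ring
  have hB : |(G *ᵥ g) x * ((n : ℝ) ^ 2 * ∑ x'' ∈ boxNbrs _ x, (h x'' - h x))| ≤ c' * κ₂ * E * F := by
    rw [abs_mul]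
    have h1 := hval x 0 (by rw [sub_self, supNorm_zero'])
    rw [mul_zero, zero_div, Real.exp_zero, mul_one] at h1
    calc |(G *ᵥ g) x| * |(n : ℝ) ^ 2 * ∑ x'' ∈ boxNbrs _ x, (h x'' - h x)| ≤ (c' * E * F) * κ₂ :=
          mul_le_mul h1 (hLap x) (abs_nonneg _) (by positivity)
      _ = c' * κ₂ * E * F := by ring
  have hC : |∑ x'' : ↥(boxDom (fun i => n * ((ℓ + 1) * M' i))),
      vEntry hn ℓ aj a Λ x x'' * (h x - h x'') * (G *ᵥ g) x''|
      ≤ (aj + a) * ((ℓ : ℝ) + 1) * Real.exp (δ' * ((ℓ : ℝ) + 1)) * c' * κ₁ * E * F := by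
    calc |∑ x'' : ↥(boxDom (fun i => n * ((ℓ + 1) * M' i))), vEntry hn ℓ aj a Λ x x'' * (h x - h x'') * (G *ᵥ g) x''|
        ≤ ∑ x'' : ↥(boxDom (fun i => n * ((ℓ + 1) * M' i))),
            vEntry hn ℓ aj a Λ x x'' * (((ℓ : ℝ) + 1) * κ₁ * (c' * Real.exp (δ' * ((ℓ : ℝ) + 1)) * E * F)) := by
          refine (Finset.abs_sum_le_sum_abs _ _).trans (Finset.sum_le_sum fun x'' _ => ?_)
          have hV0 := vEntry_nonneg hn ℓ haj ha Λ x x''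
          by_cases hz : vEntry hn ℓ aj a Λ x x'' = 0
          · rw [hz]; simp
          · have hd := supNorm_le_of_vEntry_ne_zero hn ℓ aj a Λ hz
            rw [abs_mul, abs_mul, abs_of_nonneg hV0, mul_assoc]
            refine mul_le_mul_of_nonneg_left ?_ hV0
            have hv := hval x'' _ hd
            rw [show δ' * ((n : ℝ) * ((ℓ : ℝ) + 1)) / n = δ' * ((ℓ : ℝ) + 1) by field_simp] at hv
            refine mul_le_mul ?_ hv (abs_nonneg _) (by positivity)
            have h1 := hLip x'' x
            calc |h x - h x''| ≤ κ₁ * supNorm (x.1 - x''.1) / n := h1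
              _ ≤ κ₁ * ((n : ℝ) * ((ℓ : ℝ) + 1)) / n := by gcongr
              _ = ((ℓ : ℝ) + 1) * κ₁ := by field_simp
      _ = (∑ x'' : ↥(boxDom (fun i => n * ((ℓ + 1) * M' i))), vEntry hn ℓ aj a Λ x x'')
            * (((ℓ : ℝ) + 1) * κ₁ * (c' * Real.exp (δ' * ((ℓ : ℝ) + 1)) * E * F)) := (Finset.sum_mul _ _ _).symm
      _ ≤ (aj + a) * (((ℓ : ℝ) + 1) * κ₁ * (c' * Real.exp (δ' * ((ℓ : ℝ) + 1)) * E * F)) :=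
          mul_le_mul_of_nonneg_right (sum_vEntry_le hn haj ha Λ x) (by positivity)
      _ = (aj + a) * ((ℓ : ℝ) + 1) * Real.exp (δ' * ((ℓ : ℝ) + 1)) * c' * κ₁ * E * F := by ring
  calc |∑ x'' ∈ boxNbrs _ x, ((n : ℝ) * (h x'' - h x)) * ((n : ℝ) * ((G *ᵥ g) x'' - (G *ᵥ g) x))
        + (G *ᵥ g) x * ((n : ℝ) ^ 2 * ∑ x'' ∈ boxNbrs _ x, (h x'' - h x))
        + ∑ x'' : ↥(boxDom (fun i => n * ((ℓ + 1) * M' i))),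
          vEntry hn ℓ aj a Λ x x'' * (h x - h x'') * (G *ᵥ g) x''|
      ≤ |∑ x'' ∈ boxNbrs _ x, ((n : ℝ) * (h x'' - h x)) * ((n : ℝ) * ((G *ᵥ g) x'' - (G *ᵥ g) x))|
        + |(G *ᵥ g) x * ((n : ℝ) ^ 2 * ∑ x'' ∈ boxNbrs _ x, (h x'' - h x))|
        + |∑ x'' : ↥(boxDom (fun i => n * ((ℓ + 1) * M' i))),
          vEntry hn ℓ aj a Λ x x'' * (h x - h x'') * (G *ᵥ g) x''| :=
        (abs_add_le _ _).trans (add_le_add (abs_add_le _ _) le_rfl)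
    _ ≤ 2 * (d + 1) * cD * Real.exp δ' * κ₁ * E * F + c' * κ₂ * E * F
        + (aj + a) * ((ℓ : ℝ) + 1) * Real.exp (δ' * ((ℓ : ℝ) + 1)) * c' * κ₁ * E * F :=
        add_le_add (add_le_add hA hB) hC
    _ = _ := by rw [hE]; ring

/-- **[B6] (2.44) FOR THE GENUINE TWO-LEVEL CUBE OPERATOR AT MESH `L^{−j}`, UNIFORMLY IN `j`**:
`|(K(h_□)G′(□)h_□λ)(x)| ≤ O(M^{−1})e^{−δ₀|x−y|}|λ|`.  For every dimension `d + 1`, block size `L = ℓ + 1 ≥ 2` and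
window there are `δ′, C > 0` such that for EVERY `j ≥ 1` (`n = L^j`), every point of the window, every box built of
`L`-blocks, every `Λ ⊆ □^{(j)}` that is a union of `L`-blocks, every cut-off `h` with
`|h(x″) − h(x)| ≤ κ₁|x″ − x|_∞/n` (unit-scale Lipschitz constant `κ₁ ≥ 0`) and `|n²Σ_{x″∼x}(h(x″) − h(x))| ≤ κ₂`
(unit-scale Laplacian), every `g` with `|g| ≤ F` (e.g. `g = h_□λ`, `|h_□| ≤ 1`) and every `D ≤ dist_∞(x, supp g)`
(fine units): `|(K(h)G′(□)g)(x)| ≤ C(κ₁ + κ₂)e^{−δ′D/L^j}F`.  For the rescaled profiles `h_□` of (2.36)/[B5] (1.118),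
which vary on the scale `M` of the unit lattice, `κ₁ = O(M^{−1})`, `κ₂ = O(M^{−2})` — the printed `O(M^{−1})`.
Route = the print's: (2.40) (`kComm_mulVec`, `lap_comm_sum_eq`, `twoLevelOp_apply'`) and both quantities of (2.43)
(`ineq243_twoLevel_roww`, `ineq243_twoLevel_deriv_wsum`).  HONEST SCOPE: `A = 0`; the box operator (Neumann) in
place of the torus `Δ′_a` (they agree on cut-offs vanishing at `∂□`; not re-proved here); `D ≤ dist(x, supp g)` in
place of «supp λ ⊂ B^j(y)» (then `|x − y| ≤ dist(x, supp λ) + 1`); constants depend on `d`, `ℓ`, the window.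
[cite: Balaban1984PropagatorsII, (2.44) p.230] -/
theorem ineq244_twoLevel (d ℓ : ℕ) (hℓ : 1 ≤ ℓ) (aminus aplus m2plus a2minus a2plus : ℝ) (ha : 0 < aminus)
    (ha2 : 0 < a2minus) :
    ∃ δ' C : ℝ, 0 < δ' ∧ 0 < C ∧ ∀ (k : ℕ), 1 ≤ k → ∀ (aj m2 a : ℝ), aminus ≤ aj → aj ≤ aplus → 0 ≤ m2 →
      m2 ≤ m2plus → a2minus ≤ a → a ≤ a2plus → ∀ (M' : Fin (d + 1) → ℕ), (∀ i, 1 ≤ M' i) →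
        ∀ (Λ : Finset ↥(boxDom (fun i => (ℓ + 1) * M' i))), IsBlockUnion ℓ M' Λ →
        ∀ (h : ↥(boxDom (fun i => (ℓ + 1) ^ k * ((ℓ + 1) * M' i))) → ℝ) (κ₁ κ₂ : ℝ), 0 ≤ κ₁ →
          (∀ z z' : ↥(boxDom (fun i => (ℓ + 1) ^ k * ((ℓ + 1) * M' i))),
            |h z' - h z| ≤ κ₁ * supNorm (z'.1 - z.1) / (((ℓ + 1) ^ k : ℕ) : ℝ)) →
          (∀ z : ↥(boxDom (fun i => (ℓ + 1) ^ k * ((ℓ + 1) * M' i))),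
            |(((ℓ + 1) ^ k : ℕ) : ℝ) ^ 2 * ∑ z' ∈ boxNbrs _ z, (h z' - h z)| ≤ κ₂) →
          ∀ (g : ↥(boxDom (fun i => (ℓ + 1) ^ k * ((ℓ + 1) * M' i))) → ℝ) (F Dd : ℝ), (∀ x', |g x'| ≤ F) →
          ∀ x : ↥(boxDom (fun i => (ℓ + 1) ^ k * ((ℓ + 1) * M' i))),
            (∀ x', g x' ≠ 0 → Dd ≤ supNorm (x.1 - x'.1)) →
              |(kComm (twoLevelOp ((ℓ + 1) ^ k) ℓ aj a m2 M' Λ) h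
                  *ᵥ (gTwoLevel ((ℓ + 1) ^ k) ℓ aj a m2 M' Λ *ᵥ g)) x|
                ≤ C * (κ₁ + κ₂) * Real.exp (-(δ' * Dd / (((ℓ + 1) ^ k : ℕ) : ℝ))) * F := by
  obtain ⟨δ₁, c₁, hδ₁, hc₁, h1⟩ := ineq243_twoLevel_roww d ℓ hℓ aminus aplus m2plus a2minus a2plus ha ha2
  obtain ⟨δ₂, c₂, hδ₂, hc₂, h2⟩ := ineq243_twoLevel_deriv_wsum d ℓ hℓ aminus aplus m2plus a2minus a2plus ha ha2
  have hδ'pos : 0 < min δ₁ δ₂ := lt_min hδ₁ hδ₂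
  refine ⟨min δ₁ δ₂, 2 * (d + 1) * c₂ * Real.exp (min δ₁ δ₂)
    + (|aplus| + |a2plus|) * ((ℓ : ℝ) + 1) * Real.exp (min δ₁ δ₂ * ((ℓ : ℝ) + 1)) * c₁ + c₁,
    hδ'pos, by positivity, ?_⟩
  intro k hk aj m2 a e1 e2 e3 e4 e5 e6 M' hM Λ hΛ h κ₁ κ₂ hκ₁ hLip hLap g F Dd hF x hD
  have hn1 : 1 ≤ (ℓ + 1) ^ k := Nat.one_le_pow _ _ (by omega)
  have haj : 0 < aj := lt_of_lt_of_le ha e1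
  have ha0 : 0 ≤ a := le_trans ha2.le e5
  have hF0 : 0 ≤ F := (abs_nonneg _).trans (hF x)
  have hκ₂ : 0 ≤ κ₂ := (abs_nonneg _).trans (hLap x)
  have hrow : ∀ z, roww (min δ₁ δ₂) ((ℓ + 1) ^ k) (gTwoLevel ((ℓ + 1) ^ k) ℓ aj a m2 M' Λ) z ≤ c₁ :=
    fun z => (roww_mono (min_le_left _ _) _ _ z).trans (h1 k hk aj m2 a e1 e2 e3 e4 e5 e6 M' hM Λ z)
  have hdrow : ∀ (μ : Fin (d + 1)) (z ze : ↥(boxDom (fun i => (ℓ + 1) ^ k * ((ℓ + 1) * M' i)))),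
      ze.1 = z.1 + Pi.single μ 1 →
        wsum (min δ₁ δ₂) ((ℓ + 1) ^ k) z (fun x' => ((((ℓ + 1) ^ k : ℕ)) : ℝ)
          * (gTwoLevel ((ℓ + 1) ^ k) ℓ aj a m2 M' Λ ze x' - gTwoLevel ((ℓ + 1) ^ k) ℓ aj a m2 M' Λ z x')) ≤ c₂ := by
    intro μ z ze hze
    refine (wsum_mono (min_le_right _ _) _ z _).trans ?_
    have := h2 k hk aj m2 a e1 e2 e3 e4 e5 e6 M' hM Λ μ z ze hze
    rw [wsum]
    exact this
  refine (kComm_gTwoLevel_pointwise hn1 haj ha0 hΛ hδ'pos.le hc₁.le hc₂.le hκ₁ hrow hdrow h hLip hLap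
    g hF x hD).trans ?_
  have hE := Real.exp_pos (-(min δ₁ δ₂ * Dd / ((((ℓ + 1) ^ k : ℕ)) : ℝ)))
  have hcoef : 2 * (d + 1) * c₂ * Real.exp (min δ₁ δ₂) * κ₁ + c₁ * κ₂
      + (aj + a) * ((ℓ : ℝ) + 1) * Real.exp (min δ₁ δ₂ * ((ℓ : ℝ) + 1)) * c₁ * κ₁
      ≤ (2 * (d + 1) * c₂ * Real.exp (min δ₁ δ₂)
        + (|aplus| + |a2plus|) * ((ℓ : ℝ) + 1) * Real.exp (min δ₁ δ₂ * ((ℓ : ℝ) + 1)) * c₁ + c₁) * (κ₁ + κ₂) := by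
    have t0 : aj + a ≤ |aplus| + |a2plus| := add_le_add (e2.trans (le_abs_self _)) (e6.trans (le_abs_self _))
    have t1 : (aj + a) * ((ℓ : ℝ) + 1) * Real.exp (min δ₁ δ₂ * ((ℓ : ℝ) + 1)) * c₁ * κ₁
        ≤ (|aplus| + |a2plus|) * ((ℓ : ℝ) + 1) * Real.exp (min δ₁ δ₂ * ((ℓ : ℝ) + 1)) * c₁ * κ₁ := by
      have h0 : 0 ≤ ((ℓ : ℝ) + 1) * Real.exp (min δ₁ δ₂ * ((ℓ : ℝ) + 1)) * c₁ * κ₁ := by positivity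
      nlinarith
    have t2 : 0 ≤ 2 * (d + 1) * c₂ * Real.exp (min δ₁ δ₂) * κ₂ := by positivity
    have t3 : 0 ≤ (|aplus| + |a2plus|) * ((ℓ : ℝ) + 1) * Real.exp (min δ₁ δ₂ * ((ℓ : ℝ) + 1)) * c₁ * κ₂ := by
      positivity
    have t4 : 0 ≤ c₁ * κ₁ := by positivity
    nlinarith
  exact mul_le_mul_of_nonneg_right (mul_le_mul_of_nonneg_right hcoef hE.le) hF0


/-! ## §9 Non-vacuity of §7–§8 (`d + 1 = 4`, `L = 2`, windows `[1/2, 2]`, `[0, 1]`, `[1/2, 2]`) -/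

/-- the derivative clause at the physical dimension. -/
example : ∃ δ' c' : ℝ, 0 < δ' ∧ 0 < c' ∧ ∀ (k : ℕ), 1 ≤ k → ∀ (aj m2 a : ℝ), (1 / 2 : ℝ) ≤ aj → aj ≤ 2 → 0 ≤ m2 →
    m2 ≤ 1 → (1 / 2 : ℝ) ≤ a → a ≤ 2 → ∀ (M' : Fin (3 + 1) → ℕ), (∀ i, 1 ≤ M' i) →
      ∀ (Λ : Finset ↥(boxDom (fun i => (1 + 1) * M' i))) (μ : Fin (3 + 1))
        (x xe : ↥(boxDom (fun i => (1 + 1) ^ k * ((1 + 1) * M' i)))), xe.1 = x.1 + Pi.single μ 1 →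
        ∑ x', |(((1 + 1) ^ k : ℕ) : ℝ) * (gTwoLevel ((1 + 1) ^ k) 1 aj a m2 M' Λ xe x'
              - gTwoLevel ((1 + 1) ^ k) 1 aj a m2 M' Λ x x')|
            * Real.exp (δ' * supNorm (x.1 - x'.1) / (((1 + 1) ^ k : ℕ) : ℝ)) ≤ c' :=
  ineq243_twoLevel_deriv_wsum 3 1 le_rfl (1 / 2) 2 1 (1 / 2) 2 (by norm_num) (by norm_num)

/-- (2.44) at the physical dimension: the quantifier prefix of `ineq244_twoLevel` is met. -/
example : ∃ δ' C : ℝ, 0 < δ' ∧ 0 < C ∧ ∀ (k : ℕ), 1 ≤ k → ∀ (aj m2 a : ℝ), (1 / 2 : ℝ) ≤ aj → aj ≤ 2 → 0 ≤ m2 →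
    m2 ≤ 1 → (1 / 2 : ℝ) ≤ a → a ≤ 2 → ∀ (M' : Fin (3 + 1) → ℕ), (∀ i, 1 ≤ M' i) →
      ∀ (Λ : Finset ↥(boxDom (fun i => (1 + 1) * M' i))), IsBlockUnion 1 M' Λ →
      ∀ (h : ↥(boxDom (fun i => (1 + 1) ^ k * ((1 + 1) * M' i))) → ℝ) (κ₁ κ₂ : ℝ), 0 ≤ κ₁ →
        (∀ z z' : ↥(boxDom (fun i => (1 + 1) ^ k * ((1 + 1) * M' i))),
          |h z' - h z| ≤ κ₁ * supNorm (z'.1 - z.1) / (((1 + 1) ^ k : ℕ) : ℝ)) →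
        (∀ z : ↥(boxDom (fun i => (1 + 1) ^ k * ((1 + 1) * M' i))),
          |(((1 + 1) ^ k : ℕ) : ℝ) ^ 2 * ∑ z' ∈ boxNbrs _ z, (h z' - h z)| ≤ κ₂) →
        ∀ (g : ↥(boxDom (fun i => (1 + 1) ^ k * ((1 + 1) * M' i))) → ℝ) (F Dd : ℝ), (∀ x', |g x'| ≤ F) →
        ∀ x : ↥(boxDom (fun i => (1 + 1) ^ k * ((1 + 1) * M' i))),
          (∀ x', g x' ≠ 0 → Dd ≤ supNorm (x.1 - x'.1)) →
            |(kComm (twoLevelOp ((1 + 1) ^ k) 1 aj a m2 M' Λ) h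
                *ᵥ (gTwoLevel ((1 + 1) ^ k) 1 aj a m2 M' Λ *ᵥ g)) x|
              ≤ C * (κ₁ + κ₂) * Real.exp (-(δ' * Dd / (((1 + 1) ^ k : ℕ) : ℝ))) * F :=
  ineq244_twoLevel 3 1 le_rfl (1 / 2) 2 1 (1 / 2) 2 (by norm_num) (by norm_num)

/-- the cut-off hypotheses of `ineq244_twoLevel` are inhabited non-trivially: the constant cut-off `h ≡ 1` has
`κ₁ = κ₂ = 0` (so `K(1) = 0` and the bound is `0`), and ANY `h` meets them with `κ₁ = n·max|h(x″) − h(x)|`-type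
constants; here the constant profile on the smallest two-level box. -/
example : ∀ z z' : ↥(boxDom (fun i => (1 + 1) ^ 1 * ((1 + 1) * (fun _ : Fin (3 + 1) => 1) i))),
    |(fun _ => (1 : ℝ)) z' - (fun _ => (1 : ℝ)) z| ≤ 0 * supNorm (z'.1 - z.1) / (((1 + 1) ^ 1 : ℕ) : ℝ) := by
  intro z z'
  simp


/-! ## §10 (2.40) for the genuine two-level operator, and the symmetry of `G′(□)` -/

/-- **[B6] (2.40) FOR THE GENUINE TWO-LEVEL CUBE OPERATOR AT MESH `L^{−j}`** (the rescaled two-scale display, both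
branches): for every cut-off `h` and every `u`,
`(K(h)u)(x) = Σ_{x″∼x, x″∈□} ξ^{−1}(h(x″) − h(x))·ξ^{−1}(u(x″) − u(x)) + u(x)·ξ^{−2}Σ_{x″∼x}(h(x″) − h(x)) + Σ_{x″} V(x, x″)(h(x) − h(x″))u(x″)`
— the three terms of (2.40): `Σ_{b∈st(x)}(∂h)(b)(∂u)(b)`, `−(Δh)(x)u(x)` (`Δ = −Σ∂²` positive) and the averaging term
`−a_jΣ_{x′∈B^j(y^j(x))}L^{−jd}(∂h)(Γ^{(j)}_{x,y^j(x),x′})u(x′)` with `(∂h)(Γ_{x,y,x′})` summed along the contour `= h(x′) − h(x)`,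
the level-`j` weights `a_jn^{−(d+1)}` off `Λ` «or … with j + 1 instead of j and with the additional factor L^{−2}» on
`Λ` (`vEntry`).  Pure algebra (no estimate): `kComm_mulVec`, `twoLevelOp_apply'`, summation by parts `lap_comm_sum_eq`.
[cite: Balaban1984PropagatorsII, (2.39) p.229, (2.40) p.230] -/
theorem eq240_twoLevel {n ℓ : ℕ} (hn : 1 ≤ n) (aj a m2 : ℝ) {M' : Fin (d + 1) → ℕ}
    {Λ : Finset ↥(boxDom (fun i => (ℓ + 1) * M' i))} (hΛ : IsBlockUnion ℓ M' Λ)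
    (h u : ↥(boxDom (fun i => n * ((ℓ + 1) * M' i))) → ℝ) (x : ↥(boxDom (fun i => n * ((ℓ + 1) * M' i)))) :
    (kComm (twoLevelOp n ℓ aj a m2 M' Λ) h *ᵥ u) x
      = ∑ x'' ∈ boxNbrs _ x, ((n : ℝ) * (h x'' - h x)) * ((n : ℝ) * (u x'' - u x))
        + u x * ((n : ℝ) ^ 2 * ∑ x'' ∈ boxNbrs _ x, (h x'' - h x))
        + ∑ x'' : ↥(boxDom (fun i => n * ((ℓ + 1) * M' i))), vEntry hn ℓ aj a Λ x x'' * (h x - h x'') * u x'' := by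
  rw [kComm_mulVec]
  simp_rw [twoLevelOp_apply' hn aj a m2 hΛ x]
  have hsplit : ∀ x'' : ↥(boxDom (fun i => n * ((ℓ + 1) * M' i))),
      ((n : ℝ) ^ 2 * neumannLapK (fun i => n * ((ℓ + 1) * M' i)) x.1 x''.1 + diagK m2 x.1 x''.1
        + vEntry hn ℓ aj a Λ x x'') * (h x - h x'') * u x''
      = (n : ℝ) ^ 2 * (neumannLapK (fun i => n * ((ℓ + 1) * M' i)) x.1 x''.1 : ℝ) * (h x - h x'') * u x''
        + (diagK m2 x.1 x''.1 : ℝ) * (h x - h x'') * u x''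
        + vEntry hn ℓ aj a Λ x x'' * (h x - h x'') * u x'' := fun x'' => by ring
  simp_rw [hsplit]
  rw [Finset.sum_add_distrib, Finset.sum_add_distrib, lap_comm_sum_eq, diag_comm_sum_eq_zero, add_zero]

/-- the printed averaging term on `Λ`: for `x` whose `j`-block lies in `Λ` the third term of (2.40) is
`a_{j+1}L^{−2}·(nL)^{−(d+1)}Σ_{x″ ∼_{j+1} x}(h(x) − h(x″))u(x″)` («with j + 1 instead of j and with the additional factor
L^{−2}»), and off `Λ` it is `a_jn^{−(d+1)}Σ_{x″ ∼_j x}(h(x) − h(x″))u(x″)`. [cite: Balaban1984PropagatorsII, (2.40) p.230] -/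
theorem vEntry_eq {n : ℕ} (hn : 1 ≤ n) (ℓ : ℕ) (aj a : ℝ) {M' : Fin (d + 1) → ℕ}
    (Λ : Finset ↥(boxDom (fun i => (ℓ + 1) * M' i))) (x x'' : ↥(boxDom (fun i => n * ((ℓ + 1) * M' i)))) :
    vEntry hn ℓ aj a Λ x x''
      = if ublk hn x ∈ Λ then
          (if blk (n * (ℓ + 1)) x''.1 = blk (n * (ℓ + 1)) x.1 then
            aNext ℓ aj a / (((ℓ : ℝ) + 1)) ^ 2 * ((((n : ℝ) * ((ℓ : ℝ) + 1)) ^ (d + 1))⁻¹) else 0)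
        else (if blk n x''.1 = blk n x.1 then aj * ((n : ℝ) ^ (d + 1))⁻¹ else 0) := rfl

/-- `C_Λ^{(j)}(□)` is a symmetric matrix (the compression of the symmetric `Δ^{(j)}(□) + aL^{−2}P` is symmetric, and so
is its inverse). [cite: Balaban1983RegularityDecay, p. 573 (1.13), dictionary] -/
theorem cΛ_isSymm (n ℓ : ℕ) (aj a m2 : ℝ) (M' : Fin (d + 1) → ℕ)
    (Λ : Finset ↥(boxDom (fun i => (ℓ + 1) * M' i))) : (cΛ n ℓ aj a m2 M' Λ).IsSymm := by
  have hS : (covOpSub n ℓ aj a m2 M' (fun y : ↥Λ => y.1)).IsSymm := (covOp_isSymm n ℓ aj a m2 M').submatrix _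
  unfold cΛ Matrix.IsSymm
  rw [Matrix.transpose_nonsing_inv, hS.eq]

/-- **`G′(□)` IS SYMMETRIC** (so its column sums obey the row bounds, `B4Thm110ZeroBox.colSum_le_roww`, and
`Q_jG′(□)`/`G′(□)Q_j^*` are mutually adjoint as used around (2.42)). [cite: Balaban1984PropagatorsII, (2.42) p.230] -/
theorem gTwoLevel_isSymm (n ℓ : ℕ) (aj a m2 : ℝ) (M' : Fin (d + 1) → ℕ)
    (Λ : Finset ↥(boxDom (fun i => (ℓ + 1) * M' i))) : (gTwoLevel n ℓ aj a m2 M' Λ).IsSymm := by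
  have hG := boxOpR_inv_isSymm n aj m2 (fun i => (ℓ + 1) * M' i)
  have hC := cΛ_isSymm n ℓ aj a m2 M' Λ
  unfold gTwoLevel
  refine Matrix.IsSymm.add hG (Matrix.IsSymm.smul ?_ _)
  unfold Matrix.IsSymm at hG hC ⊢
  simp only [Matrix.transpose_mul, Matrix.transpose_transpose, hG, hC, Matrix.mul_assoc]

/-- the uniform `ℓ^∞ → ℓ^∞` and (by symmetry) `ℓ¹ → ℓ¹` operator bounds of `G′(□)`, uniformly in the mesh: with the
constants of `ineq243_twoLevel_roww`, `Σ_{x′}|G′(□; x, x′)| ≤ c′` and `Σ_{x}|G′(□; x, x′)| ≤ c′`.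
[cite: Balaban1984PropagatorsII, (2.43) p.230] -/
theorem ineq243_twoLevel_rowSum_colSum (d ℓ : ℕ) (hℓ : 1 ≤ ℓ) (aminus aplus m2plus a2minus a2plus : ℝ)
    (ha : 0 < aminus) (ha2 : 0 < a2minus) :
    ∃ c' : ℝ, 0 < c' ∧ ∀ (k : ℕ), 1 ≤ k → ∀ (aj m2 a : ℝ), aminus ≤ aj → aj ≤ aplus → 0 ≤ m2 →
      m2 ≤ m2plus → a2minus ≤ a → a ≤ a2plus → ∀ (M' : Fin (d + 1) → ℕ), (∀ i, 1 ≤ M' i) →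
        ∀ (Λ : Finset ↥(boxDom (fun i => (ℓ + 1) * M' i)))
          (x : ↥(boxDom (fun i => (ℓ + 1) ^ k * ((ℓ + 1) * M' i)))),
          ∑ x', |gTwoLevel ((ℓ + 1) ^ k) ℓ aj a m2 M' Λ x x'| ≤ c' ∧
          ∑ x', |gTwoLevel ((ℓ + 1) ^ k) ℓ aj a m2 M' Λ x' x| ≤ c' := by
  obtain ⟨δ', c', hδ', hc', h⟩ := ineq243_twoLevel_roww d ℓ hℓ aminus aplus m2plus a2minus a2plus ha ha2
  refine ⟨c', hc', ?_⟩
  intro k hk aj m2 a h1 h2 h3 h4 h5 h6 M' hM Λ x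
  have hr := h k hk aj m2 a h1 h2 h3 h4 h5 h6 M' hM Λ x
  exact ⟨(rowSum_le_roww hδ'.le _ _ x).trans hr,
    (colSum_le_roww hδ'.le _ (gTwoLevel_isSymm _ _ _ _ _ _ _) x).trans hr⟩

end

end Literature.MathematicalPhysics.QuantumFieldTheory.Balaban1983to89.B6Ineq243TwoLevelBox
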